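import Literature.MathematicalPhysics.QuantumFieldTheory.Balaban1983to89.B1Eq324BenfattoKernelSect5LedgerPrice
import Literature.MathematicalPhysics.QuantumFieldTheory.Balaban1983to89.B1Eq324BenfattoKernelSect5LedgerPerBox
import Literature.MathematicalPhysics.QuantumFieldTheory.Balaban1983to89.B1Eq324BenfattoKernelSect5LedgerCumulant
import Literature.MathematicalPhysics.QuantumFieldTheory.Balaban1983to89.B1Eq324BenfattoSect5LedgerDischargeLower
import HarnessLib

/-!
# `Balaban1983to89.B1Eq324BenfattoKernelSect5LedgerDischargeLower` — [BenfattoEtAl1978] p. 152 (4.7), p. 159 «Collecting all the errors» and «b*», for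
# the class of [Balaban1985BackgroundPropagators] Sect. E p. 428: the LEDGER DISCHARGE of the class (4.7) knit (seat n08-c's `…KernelSect5LowerAssembly`),
# LOWER HALF — the nI-form ledger of every stopping index `n ≤ d + 1` is `≤ nI·errTerm S ρ₁ ρ₂ ρ₃ ρ₄ A b t` from ONE free-field threshold — PROVED

statement-level skeleton of published theorems with citation tags; proofs where landed; nothing here is a claim about the
Yang–Mills mass gap

WHY THIS MODULE (cell `pub-ymgap`, seat `dag-n08-b` gen 13; node N08 [Balaban1985UV3]; the class twin of seat n08-c's print pack
`…Sect5LedgerDischargeLower.lowerpack` over MY toolkit).  Seat n08-c's class knit `…KernelSect5LowerAssembly.exp_cumulantSum_sub_le_integral_of_ledger`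
proves (4.7) for the Gaussian field of a class kernel from ONE displayed real inequality `hledger : Σ_{k<n}(c_k + idErr_k) + |I|·(class Appendix-A term) ≤ E_tot`.
After the knit's conversion to nI-FORM (counts `|J_k|, |B_k| ↦ nI`, `|Γ̄₁(B_k)| ↦ nI·L^d`, `Σ_□ ↦ nI·` at `|□′| ↦ L^d`; the decoupling price in CLOSED form by
`…LedgerPrice.two_mul_price_le_closed`, which needs `B_k ≠ ∅` — hence the STOPPING INDEX `n ≤ d+1` = the first step with `J_n = ∅`; the letters
`K_u, K₀, ε₃₁` at the choices `(1+VM/(γ_A−J_c))(γb_k)`, `max(max 1 (1/(γ_A−J_c)), K_u)`, `ε₁ + ε₂` whose ties hold by `K0_ties` / `le_rfl`), that ledger is a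
closed real expression in `(s, n, nI, A, b, L, w, v)` and the class constants; this file proves it is `≤ nI·errTerm S ρ₁ ρ₂ ρ₃ ρ₄ A b t` for print's exponent
ranges from ONE threshold `b*` free of `t, D, ϰ`, with the same `S` for every `n ≤ d+1`, together with every geometric side condition of the class chain
(`2(2w+v) < L`, `(d+1)·2(2w+v) ≤ L`, `v ≤ w`, `1 ≤ w`, `1 ≤ γ^{d+1}b`, `L^d e^{−(γ^d b)²/4} ≤ 1/6`, the guard `J_c/(cosh θw − 1) < γ_A`, the terminal rows
`4/γ_A ≤ (γⁿb)²`), in print's two regimes with the NARROW WIDTH `v₀ = ⌈1/(2θ) + √(J_c/γ_A)/θ⌉ + 1` below `b₀` (so the guard holds there too).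

WHAT IS PROVED (theorems only; no definition, no named fact, no `sorry`; axioms standard).
* §1 rows of the knit's letters: `Ku_row`, `Ku_nonneg`, `K0_row`, `K0_ties`, ★ `eps31_row` (`ε₁ + ε₂ ≤ C_ε·b³·e^{−(θ/4)(w−v)}`).
* §2 the fold `nsmul_shape5_appA_le_errTerm` (five summands per step, `n ≤ m` steps, Appendix-A atom; `S` free of `n` and of every sign).
* §3 ★★★ `lowerpack_class` — the class LOWER PACK (statement shape = print's `lowerpack` + the stopping index; atoms: print's `struct₁/₂_le`,
  `errPB_remainder_le`, `errPB_eps_le` by name; class `closed_price_le_errTerm`, `errPB_volume/chi/d29/d31_class_le`, `cum_*_class_le`,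
  `appendixA_class_term_le_snd`; parameters by `…LedgerPrice` §4 and `…LedgerDischargeUpper.exists_M_upper` at the extra rate `θ/4`).

HONEST SCOPE / NOT HERE.  Elementary real analysis over displayed closed terms; no measure theory; the conversion of the knit's geometric `hledger` to
nI-form (three monotone steps) and the ∃-knit of the class Basic Lemma are seat n08-c's; the UPPER pack follows the (4.6) knit; no generalised Basic Lemma is
stated here; count-neutral for N08; nothing of [Balaban1985UV3] (41)/(47)/(5) is asserted; nothing about d = 4, the continuum, OS axioms, a mass gap or
the Clay problem.
-/
noncomputable section

open Finset
open scoped BigOperators Nat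

namespace Literature.MathematicalPhysics.QuantumFieldTheory.Balaban1983to89.B1Eq324BenfattoKernelSect5LedgerDischargeLower

open Literature.MathematicalPhysics.QuantumFieldTheory.Balaban1983to89.B1Eq324BenfattoLemma
open Literature.MathematicalPhysics.QuantumFieldTheory.Balaban1983to89.B1Eq324BenfattoSect5ErrTermLedger
open Literature.MathematicalPhysics.QuantumFieldTheory.Balaban1983to89.B1Eq324BenfattoSect5Eq511 (s1Const)
open Literature.MathematicalPhysics.QuantumFieldTheory.Balaban1983to89.B1Eq324GaussianMomentLeaf (momentConst)
open Literature.Probability.LatticeModels (setPartitions)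
open Literature.MathematicalPhysics.QuantumFieldTheory.Balaban1983to89.B1Eq324BenfattoSect5LedgerDischarge
open Literature.MathematicalPhysics.QuantumFieldTheory.Balaban1983to89.B1Eq324BenfattoKernelSect5LedgerPrice
open Literature.MathematicalPhysics.QuantumFieldTheory.Balaban1983to89.B1Eq324BenfattoKernelSect5LedgerPerBox
open Literature.MathematicalPhysics.QuantumFieldTheory.Balaban1983to89.B1Eq324BenfattoKernelSect5LedgerCumulant
open Literature.MathematicalPhysics.QuantumFieldTheory.Balaban1983to89.B1Eq324BenfattoSect5LedgerDischargeCumulant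
open Literature.MathematicalPhysics.QuantumFieldTheory.Balaban1983to89.B1Eq324BenfattoSect5LedgerDischargeUpper
open Literature.MathematicalPhysics.QuantumFieldTheory.Balaban1983to89.B1Eq324BenfattoSect5LedgerDischargeLower (cutoff_lower)

variable {d : ℕ}

/-! ## §1  The class letters of the knit in ledger normal form -/

section Rows

variable {γA Jc V M V₂ M₂ V₄ θ γ b c Γ : ℝ} {L w v : ℕ}

/-- **The centre letter `K_u = (1 + VM/(γ_A − J_c))·(γc)` in normal form**: `K_u ≤ ((1 + VM/(γ_A − J_c))·Γ)·b` at a cut-off `0 ≤ c ≤ Γb`, `γ ≤ 1`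
(`V, M ≥ 0`, `J_c < γ_A`). [cite: BenfattoEtAl1978, (C.8) p.165 (class form; ours); Balaban1985BackgroundPropagators, Sect. E p.428] -/
theorem Ku_row (hV : 0 ≤ V) (hM : 0 ≤ M) (hJcγ : Jc < γA) (hγ1 : γ ≤ 1) (hc : 0 ≤ c) (hcb : c ≤ Γ * b) :
    (1 + V * M / (γA - Jc)) * (γ * c) ≤ ((1 + V * M / (γA - Jc)) * Γ) * b := by
  have hq : 0 ≤ 1 + V * M / (γA - Jc) := by
    have : 0 ≤ V * M / (γA - Jc) := div_nonneg (mul_nonneg hV hM) (by linarith)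
    linarith
  exact mul_cutoff_le_mul hq hγ1 hc hcb

/-- `0 ≤ K_u`. [cite: BenfattoEtAl1978, (C.8) p.165 (class form; ours)] -/
theorem Ku_nonneg (hV : 0 ≤ V) (hM : 0 ≤ M) (hJcγ : Jc < γA) (hγ0 : 0 ≤ γ) (hc : 0 ≤ c) :
    0 ≤ (1 + V * M / (γA - Jc)) * (γ * c) := by
  have : 0 ≤ V * M / (γA - Jc) := div_nonneg (mul_nonneg hV hM) (by linarith)
  exact mul_nonneg (by linarith) (mul_nonneg hγ0 hc)

/-- **The propagator letter `K₀ = max(max 1 (1/(γ_A − J_c)), K_u)` in normal form**: `K₀ ≤ (max 1 (1/(γ_A−J_c)) + (1 + VM/(γ_A−J_c))·Γ)·b`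
(`b ≥ 1`). [cite: BenfattoEtAl1978, Appendix D p.165 (class form; ours); Balaban1985BackgroundPropagators, Sect. E p.428] -/
theorem K0_row (hV : 0 ≤ V) (hM : 0 ≤ M) (hJcγ : Jc < γA) (hb : 1 ≤ b) (hγ1 : γ ≤ 1) (hc : 0 ≤ c) (hcb : c ≤ Γ * b) :
    max (max 1 (1 / (γA - Jc))) ((1 + V * M / (γA - Jc)) * (γ * c)) ≤ (max 1 (1 / (γA - Jc)) + (1 + V * M / (γA - Jc)) * Γ) * b := by
  have hq : 0 ≤ 1 + V * M / (γA - Jc) := by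
    have : 0 ≤ V * M / (γA - Jc) := div_nonneg (mul_nonneg hV hM) (by linarith)
    linarith
  exact max_max_one_le_mul hb hq hγ1 hc hcb

/-- `1 ≤ K₀` and `1/(γ_A − J_c) ≤ K₀` and `K_u ≤ K₀` (the knit's ties `hK₀1`, `hK₀`, `hKuK` for this choice). [cite: BenfattoEtAl1978, Appendix D p.165 (class form; ours)] -/
theorem K0_ties (Ku C : ℝ) : 1 ≤ max (max 1 C) Ku ∧ C ≤ max (max 1 C) Ku ∧ Ku ≤ max (max 1 C) Ku :=
  ⟨(le_max_left _ _).trans (le_max_left _ _), (le_max_right _ _).trans (le_max_left _ _), le_max_right _ _⟩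

/-- **The (5.31) letter `ε₃₁ := ε₁ + ε₂` in normal form**: with `ε₁ = V₂M₂/(γ_A−J_c)²·e^{−(θ/2)n} + e^{−θn}/(γ_A−J_c)` and
`ε₂ = M₂/(γ_A−J_c)·(γc)·(1+√d(L−1))·V₄·e^{−(θ/4)n}` (`n = w − v`; the knit's ties `hε₁`, `hε₂` hold for the SUM since both are `≥ 0`):
`ε₁ + ε₂ ≤ (V₂M₂/(γ_A−J_c)² + 1/(γ_A−J_c) + M₂/(γ_A−J_c)·Γ·(1+2√d)·V₄)·b³·e^{−(θ/4)n}` at a cut-off `0 ≤ c ≤ Γb`, `1 ≤ L ≤ 2b²`, `b ≥ 1`, `θ ≥ 0`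
(`V₂, M₂, V₄ ≥ 0`, `J_c < γ_A`, `0 ≤ γ ≤ 1`). [cite: BenfattoEtAl1978, (5.31) p.158, (C.7)–(C.8) p.165 (class form; ours); Balaban1985BackgroundPropagators, Sect. E p.428] -/
theorem eps31_row (hV₂ : 0 ≤ V₂) (hM₂ : 0 ≤ M₂) (hV₄ : 0 ≤ V₄) (hJcγ : Jc < γA) (hθ : 0 ≤ θ) (hb : 1 ≤ b) (hγ0 : 0 ≤ γ) (hγ1 : γ ≤ 1)
    (hc : 0 ≤ c) (hcb : c ≤ Γ * b) (hL1 : 1 ≤ ((L : ℕ) : ℝ)) (hL : ((L : ℕ) : ℝ) ≤ 2 * b ^ 2) (n : ℕ) :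
    (V₂ * M₂ / (γA - Jc) ^ 2 * Real.exp (-(θ / 2 * (n : ℝ))) + Real.exp (-(θ * (n : ℝ))) / (γA - Jc)) +
        M₂ / (γA - Jc) * (γ * c) * (1 + Real.sqrt d * (((L : ℕ) : ℝ) - 1)) * V₄ * Real.exp (-(θ / 4 * (n : ℝ))) ≤
      (V₂ * M₂ / (γA - Jc) ^ 2 + 1 / (γA - Jc) + M₂ / (γA - Jc) * Γ * (1 + 2 * Real.sqrt d) * V₄) * b ^ 3 *
        Real.exp (-(θ / 4 * (n : ℝ))) := by
  have hgap : 0 < γA - Jc := by linarith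
  have hb0 : 0 ≤ b := zero_le_one.trans hb
  have hn0 : (0 : ℝ) ≤ n := Nat.cast_nonneg n
  have hb3 : 1 ≤ b ^ 3 := one_le_pow₀ hb
  set e4 : ℝ := Real.exp (-(θ / 4 * (n : ℝ))) with he4
  have he40 : 0 < e4 := Real.exp_pos _
  -- the two slower exponentials are below `e^{−(θ/4)n}`
  have h2 : Real.exp (-(θ / 2 * (n : ℝ))) ≤ e4 := Real.exp_le_exp.mpr (by nlinarith)
  have h1 : Real.exp (-(θ * (n : ℝ))) ≤ e4 := Real.exp_le_exp.mpr (by nlinarith)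
  have hA0 : 0 ≤ V₂ * M₂ / (γA - Jc) ^ 2 := by positivity
  have hB0 : 0 ≤ 1 / (γA - Jc) := by positivity
  have hC0 : 0 ≤ M₂ / (γA - Jc) := by positivity
  -- ε₁
  have hε₁ : V₂ * M₂ / (γA - Jc) ^ 2 * Real.exp (-(θ / 2 * (n : ℝ))) + Real.exp (-(θ * (n : ℝ))) / (γA - Jc) ≤
      (V₂ * M₂ / (γA - Jc) ^ 2 + 1 / (γA - Jc)) * b ^ 3 * e4 := by
    have ha : V₂ * M₂ / (γA - Jc) ^ 2 * Real.exp (-(θ / 2 * (n : ℝ))) ≤ V₂ * M₂ / (γA - Jc) ^ 2 * e4 :=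
      mul_le_mul_of_nonneg_left h2 hA0
    have hb' : Real.exp (-(θ * (n : ℝ))) / (γA - Jc) ≤ 1 / (γA - Jc) * e4 := by
      rw [div_eq_mul_one_div, mul_comm]
      exact mul_le_mul_of_nonneg_left h1 hB0
    have hsum : V₂ * M₂ / (γA - Jc) ^ 2 * e4 + 1 / (γA - Jc) * e4 = (V₂ * M₂ / (γA - Jc) ^ 2 + 1 / (γA - Jc)) * 1 * e4 := by ring
    calc _ ≤ V₂ * M₂ / (γA - Jc) ^ 2 * e4 + 1 / (γA - Jc) * e4 := add_le_add ha hb'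
      _ = (V₂ * M₂ / (γA - Jc) ^ 2 + 1 / (γA - Jc)) * 1 * e4 := hsum
      _ ≤ (V₂ * M₂ / (γA - Jc) ^ 2 + 1 / (γA - Jc)) * b ^ 3 * e4 :=
          mul_le_mul_of_nonneg_right (mul_le_mul_of_nonneg_left hb3 (by positivity)) he40.le
  -- ε₂
  have hγc : γ * c ≤ Γ * b := (mul_le_of_le_one_left hc hγ1).trans hcb
  have hgl : 1 + Real.sqrt d * (((L : ℕ) : ℝ) - 1) ≤ (1 + 2 * Real.sqrt d) * b ^ 2 := by
    have hd0 : 0 ≤ Real.sqrt d := Real.sqrt_nonneg _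
    have h1 : ((L : ℕ) : ℝ) - 1 ≤ 2 * b ^ 2 := by linarith
    have hb2 : 1 ≤ b ^ 2 := one_le_pow₀ hb
    nlinarith [mul_le_mul_of_nonneg_left h1 hd0]
  have hgl0 : 0 ≤ 1 + Real.sqrt d * (((L : ℕ) : ℝ) - 1) := by
    have : 0 ≤ Real.sqrt d * (((L : ℕ) : ℝ) - 1) := mul_nonneg (Real.sqrt_nonneg _) (by linarith)
    linarith
  have hε₂ : M₂ / (γA - Jc) * (γ * c) * (1 + Real.sqrt d * (((L : ℕ) : ℝ) - 1)) * V₄ * e4 ≤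
      (M₂ / (γA - Jc) * Γ * (1 + 2 * Real.sqrt d) * V₄) * b ^ 3 * e4 := by
    have hγc0 : 0 ≤ γ * c := mul_nonneg hγ0 hc
    have hΓb0 : 0 ≤ M₂ / (γA - Jc) * (Γ * b) := mul_nonneg hC0 (hγc0.trans hγc)
    calc M₂ / (γA - Jc) * (γ * c) * (1 + Real.sqrt d * (((L : ℕ) : ℝ) - 1)) * V₄ * e4
        ≤ M₂ / (γA - Jc) * (Γ * b) * ((1 + 2 * Real.sqrt d) * b ^ 2) * V₄ * e4 := by gcongr
      _ = (M₂ / (γA - Jc) * Γ * (1 + 2 * Real.sqrt d) * V₄) * b ^ 3 * e4 := by ring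
  calc _ ≤ (V₂ * M₂ / (γA - Jc) ^ 2 + 1 / (γA - Jc)) * b ^ 3 * e4 + (M₂ / (γA - Jc) * Γ * (1 + 2 * Real.sqrt d) * V₄) * b ^ 3 * e4 :=
        add_le_add hε₁ hε₂
    _ = _ := by rw [he4]; ring

end Rows

/-! ## §2  The fold of one class step (five summands) and the class Appendix-A atom into `nI·errTerm S …` -/

section Algebra

/-- The final fold on the class lower side, UNIFORM IN THE STOPPING INDEX: `n ≤ m` equal per-step totals
`nI·errTerm C₁ + nI·errTerm C₂ + nI·errTerm C_P + nI·(Cr·FST + Ce·SND) + nI·errTerm Cc` (structural, structural, PRICE, per-box, cumulant) plus the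
Appendix-A atom `nI·(C_A·SND)` are at most `nI·errTerm X …` with the `n`-free
`X = max (max (m·max(C₁+C₂+C_P+Cc+Ce, 0) + C_A) (m·max(C₁+C₂+C_P+Cc+Cr, 0))) 0` — no sign information on the `C`'s is needed (the class twin of
`…Sect5LedgerDischargeLower.nsmul_shape_appA_le_errTerm` with the price summand and the stopping index). [cite: BenfattoEtAl1978, (4.7) p.152, (A.1)–(A.2) p.161] -/
theorem nsmul_shape5_appA_le_errTerm {n m : ℕ} {nI C₁ C₂ CP Cr Ce Cc CA A b ρ₁ ρ₂ ρ₃ ρ₄ : ℝ} {t : ℕ} (hnm : n ≤ m) (hnI : 0 ≤ nI) (hA : 0 ≤ A)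
    (hb : 0 ≤ b) :
    n • (nI * errTerm C₁ ρ₁ ρ₂ ρ₃ ρ₄ A b t + nI * errTerm C₂ ρ₁ ρ₂ ρ₃ ρ₄ A b t + nI * errTerm CP ρ₁ ρ₂ ρ₃ ρ₄ A b t +
        (nI * (Cr * (A * b ^ ρ₁ * Real.exp (ρ₂ * A * b ^ ρ₃)) ^ (t + 1) + Ce * (Real.exp (-(ρ₃ * b ^ (3 / 2 : ℝ))) * Real.exp (ρ₄ * A * b ^ ρ₃))) +
          nI * errTerm Cc ρ₁ ρ₂ ρ₃ ρ₄ A b t)) +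
        nI * (CA * (Real.exp (-(ρ₃ * b ^ (3 / 2 : ℝ))) * Real.exp (ρ₄ * A * b ^ ρ₃))) ≤
      nI * errTerm (max (max ((m : ℝ) * max (C₁ + C₂ + CP + Cc + Ce) 0 + CA) ((m : ℝ) * max (C₁ + C₂ + CP + Cc + Cr) 0)) 0) ρ₁ ρ₂ ρ₃ ρ₄ A b t := by
  rw [nsmul_eq_mul]
  unfold errTerm
  set F : ℝ := (A * b ^ ρ₁ * Real.exp (ρ₂ * A * b ^ ρ₃)) ^ (t + 1) with hF
  set S : ℝ := Real.exp (-(ρ₃ * b ^ (3 / 2 : ℝ))) * Real.exp (ρ₄ * A * b ^ ρ₃) with hS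
  set X : ℝ := max (max ((m : ℝ) * max (C₁ + C₂ + CP + Cc + Ce) 0 + CA) ((m : ℝ) * max (C₁ + C₂ + CP + Cc + Cr) 0)) 0 with hX
  have hF0 : 0 ≤ F := by rw [hF]; positivity
  have hS0 : 0 ≤ S := by rw [hS]; positivity
  have hnm' : (n : ℝ) ≤ m := by exact_mod_cast hnm
  have hn0 : (0 : ℝ) ≤ n := Nat.cast_nonneg n
  have hP' : (n : ℝ) * (C₁ + C₂ + CP + Cc + Ce) + CA ≤ (m : ℝ) * max (C₁ + C₂ + CP + Cc + Ce) 0 + CA := by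
    have h1 : (n : ℝ) * (C₁ + C₂ + CP + Cc + Ce) ≤ (n : ℝ) * max (C₁ + C₂ + CP + Cc + Ce) 0 :=
      mul_le_mul_of_nonneg_left (le_max_left _ _) hn0
    have h2 : (n : ℝ) * max (C₁ + C₂ + CP + Cc + Ce) 0 ≤ (m : ℝ) * max (C₁ + C₂ + CP + Cc + Ce) 0 :=
      mul_le_mul_of_nonneg_right hnm' (le_max_right _ _)
    linarith
  have hR' : (n : ℝ) * (C₁ + C₂ + CP + Cc + Cr) ≤ (m : ℝ) * max (C₁ + C₂ + CP + Cc + Cr) 0 := by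
    have h1 : (n : ℝ) * (C₁ + C₂ + CP + Cc + Cr) ≤ (n : ℝ) * max (C₁ + C₂ + CP + Cc + Cr) 0 :=
      mul_le_mul_of_nonneg_left (le_max_left _ _) hn0
    have h2 : (n : ℝ) * max (C₁ + C₂ + CP + Cc + Cr) 0 ≤ (m : ℝ) * max (C₁ + C₂ + CP + Cc + Cr) 0 :=
      mul_le_mul_of_nonneg_right hnm' (le_max_right _ _)
    linarith
  have hP : (n : ℝ) * (C₁ + C₂ + CP + Cc + Ce) + CA ≤ X := hP'.trans ((le_max_left _ _).trans (le_max_left _ _))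
  have hR : (n : ℝ) * (C₁ + C₂ + CP + Cc + Cr) ≤ X := hR'.trans ((le_max_right _ _).trans (le_max_left _ _))
  have heq : (n : ℝ) * (nI * (C₁ * (F + S)) + nI * (C₂ * (F + S)) + nI * (CP * (F + S)) + (nI * (Cr * F + Ce * S) + nI * (Cc * (F + S)))) +
      nI * (CA * S) =
      nI * (((n : ℝ) * (C₁ + C₂ + CP + Cc + Ce) + CA) * S + (n : ℝ) * (C₁ + C₂ + CP + Cc + Cr) * F) := by ring
  rw [heq]
  refine mul_le_mul_of_nonneg_left ?_ hnI
  calc ((n : ℝ) * (C₁ + C₂ + CP + Cc + Ce) + CA) * S + (n : ℝ) * (C₁ + C₂ + CP + Cc + Cr) * F ≤ X * S + X * F :=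
        add_le_add (mul_le_mul_of_nonneg_right hP hS0) (mul_le_mul_of_nonneg_right hR hF0)
    _ = X * (F + S) := by ring

end Algebra

/-! ## §3  LOWERPACK for the class: the nI-form (4.7) ledger of the class knit from ONE free-field threshold -/

section Lower

set_option maxHeartbeats 1600000 in
/-- ★ **LOWERPACK FOR THE CLASS — the LOWER half of the class ledger socket, DISCHARGED.**  For `d ≥ 1`, class constants `γ_A > J_c ≥ 0`, `θ > 0`,
`V, M, V₂, M₂, V₄ ≥ 0`, a contraction `0 < γ ≤ 1`, every `t, D`, `ϰ > 0`, all exponents with `ρ₁ ≥ D + 2d`, `ρ₂ ≥ 0`, `ρ₃ ≥ D + 2d`, `ρ₄ ≥ 8·2^d·s₁(D) + 1`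
and every threshold `b* ≥ b*₀(d, γ, γ_A, θ, J_c)` (free of `t, D, ϰ`): there are `S ≥ 0` and a rate `0 < δ ≤ θ/√d` with `δD²√d < ϰ` such that every
`b > b*` admits `L, w, v` (`L = ⌈b²⌉`, `w = 2v`, `v = ⌈M_reg b^{3/2}⌉` resp. the narrow width `v₀(θ, J_c, γ_A)`) with the geometric side conditions of the
class chain (`2(2w+v) < L`, `(d+1)·2(2w+v) ≤ L`, `v ≤ w`, `1 ≤ w`, `1 ≤ γ^{d+1}b`, `L^d e^{−(γ^d b)²/4} ≤ 1/6`, the guard `J_c/(cosh θw − 1) < γ_A`, the terminal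
cut-off row `4/γ_A ≤ (γⁿb)²` for `n ≤ d+1`), and — for all `s`, every stopping index `n ≤ d + 1`, `nI ≥ 1`, `A ≥ 0` — the nI-FORM LOWER LEDGER of
`…KernelSect5LowerAssembly.exp_cumulantSum_sub_le_integral_of_ledger` (its `hledger` with `|J_k|, |B_k| ↦ nI`, `|Γ̄₁(B_k)| ↦ nI·L^d`, `Σ_□ ↦ nI·` at
`|□′| ↦ L^d`, the price in closed form (`…LedgerPrice.two_mul_price_le_closed`), the letters `K_u, K₀, ε₃₁` at the choices
`(1+VM/(γ_A−J_c))(γb_k)`, `max(max 1 (1/(γ_A−J_c)), K_u)`, `ε₁ + ε₂`, cut-offs `b_k = γ^k b`, the class Appendix-A term at `γⁿb`)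
`≤ nI·errTerm S ρ₁ ρ₂ ρ₃ ρ₄ A b t`.  Proof: print's scheme (`…Sect5LedgerDischargeLower.lowerpack`) atom by atom at the cut-offs `c = γ^k b ∈ [γ^d b, b]`
with the class atoms of `…LedgerPrice` / `…LedgerPerBox` / `…LedgerCumulant`, the narrow width `v₀` for the guard below `b₀`, and the corridor multiplier
dominating the six rates `ϰ/4, ϰ′/2, δ/2, δ/(4(k+1)), θ, θ/4`.
[cite: BenfattoEtAl1978, Basic Lemma (4.7) p.152; §5 (5.33)–(5.35), «Collecting all the errors» p.159, «b*» p.159; Appendix A p.161;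
Balaban1985BackgroundPropagators, (1.16)–(1.18) p.180, Sect. E p.428 (class form; ours)] -/
theorem lowerpack_class (hd : 0 < d) {γA Jc θ V M V₂ M₂ V₄ : ℝ} (hγA0 : 0 < γA) (hJc0 : 0 ≤ Jc) (hJcγ : Jc < γA) (hθ : 0 < θ)
    (hV : 0 ≤ V) (hM : 0 ≤ M) (hV₂ : 0 ≤ V₂) (hM₂ : 0 ≤ M₂) (hV₄ : 0 ≤ V₄)
    {γ : ℝ} (hγ0 : 0 < γ) (hγ1 : γ ≤ 1)
    (t D : ℕ) {κ : ℝ} (hκ : 0 < κ) {ρ₁ ρ₂ ρ₃ ρ₄ : ℝ}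
    (hρ₁ : (D : ℝ) + 2 * d ≤ ρ₁) (hρ₂ : 0 ≤ ρ₂) (hρ₃ : (D : ℝ) + 2 * d ≤ ρ₃)
    (hρ₄ : 8 * s1Const D D d κ * 1 ^ D * 2 ^ d + 1 ≤ ρ₄)
    {bstar : ℝ} (hbs : 6 * 2 ^ d * ((d + 1).factorial : ℝ) * (4 / (γ ^ d) ^ 2) ^ (d + 1)
      + 10 * (d + 1) * ((⌈1 / (2 * θ) + Real.sqrt (Jc / γA) / θ⌉₊ + 1 : ℕ) : ℝ) + 2 / (γ ^ (d + 1) * Real.sqrt γA) + (γ ^ (d + 1))⁻¹ + 1 ≤ bstar) :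
    ∃ S δ : ℝ, 0 ≤ S ∧ 0 < δ ∧ δ ≤ θ / Real.sqrt d ∧ 0 < κ / 2 - δ / 2 * ((D : ℝ) ^ 2 * Real.sqrt d) ∧
      ∀ b : ℝ, bstar < b → ∃ L w v : ℕ, 2 * (2 * w + v) < L ∧ (d + 1) * (2 * (2 * w + v)) ≤ L ∧ v ≤ w ∧ 1 ≤ w ∧
        1 ≤ γ ^ (d + 1) * b ∧ ((L : ℝ) ^ d) * Real.exp (-((γ ^ d * b) ^ 2 / 4)) ≤ 1 / 6 ∧
        Jc / (Real.cosh (θ * w) - 1) < γA ∧ (∀ n : ℕ, n ≤ d + 1 → 4 * (1 / γA) ≤ (γ ^ n * b) ^ 2) ∧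
        ∀ (s n : ℕ) (nI A : ℝ), n ≤ d + 1 → 1 ≤ nI → 0 ≤ A →
          ∑ j ∈ Finset.range n,
              ((s1Const s D d κ * A * (γ ^ j * b) ^ D * Real.exp (-(κ / 4 * w)) * nI
                + s1Const s D d κ * A * (γ ^ j * b) ^ D *
                  (Real.exp (-(κ / 4 * w)) * (nI * (L : ℝ) ^ d) +
                    Real.exp (-(κ / 4 * v)) * (nI * (L : ℝ) ^ d))
                + (32 * (Jc / γA) * (2 / (1 - Real.exp (-(θ / 2 / Real.sqrt d))) * Real.exp (θ / 2 / Real.sqrt d)) ^ d +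
                    8 * Jc * ((1 + V * M / (γA - Jc) * γ) ^ 2) * (γ ^ j * b) ^ 2 *
                      ((2 * (1 + Real.sqrt d * ((L : ℝ) - 1)) ^ 2 + 128 / θ ^ 2) *
                        (2 / (1 - Real.exp (-(θ / 4 / Real.sqrt d))) * Real.exp (θ / 4 / Real.sqrt d)) ^ d)) *
                  (nI * (L : ℝ) ^ d) * Real.exp (-(θ * w / 2)))
                + (nI *
                    (2 * (2 ^ ((t + 1).choose 2) * (4 * (s1Const s D d κ * A * (γ ^ j * b) ^ D * (L : ℝ) ^ d)) ^ (t + 1) / (t + 1)!) +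
                          Real.exp (2 * (4 * (s1Const s D d κ * A * (γ ^ j * b) ^ D * (L : ℝ) ^ d))) *
                            (3 * ((L : ℝ) ^ d * Real.exp (-((γ ^ j * b) ^ 2 / 4)))) +
                          ∑ k ∈ Finset.range t,
                            (3 ^ (k + 1) * ((∑ π ∈ setPartitions (univ : Finset (Fin (k + 1))), ((π.card - 1)! : ℝ)) *
                                (s1Const s D d κ * A * (γ ^ j * b) ^ D * Real.exp (-(κ / 4 * v)) * (L : ℝ) ^ d *
                                  (4 * (s1Const s D d κ * A * (γ ^ j * b) ^ D * (L : ℝ) ^ d)) ^ k)) +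
                              3 ^ (k + 1) * (2 ^ (k + 1) * ((∑ π ∈ setPartitions (univ : Finset (Fin (k + 1))), ((π.card - 1)! : ℝ)) *
                                  ((min 1 (2 * (L : ℝ) ^ d * Real.exp (-((γ ^ j * b) ^ 2 / 4)))) ^ ((2 * (k + 1) : ℕ) : ℝ)⁻¹ *
                                    ((1 + ((1 + V * M / (γA - Jc)) * (γ * (γ ^ j * b)))) ^ D * (A * (L : ℝ) ^ d * ∑ p ∈ Finset.Icc 1 s, ((admissible p D).card : ℝ) *
                    ((2 / (1 - Real.exp (-(κ / 2 / (p : ℕ) / Real.sqrt d))) * Real.exp (κ / 2 / (p : ℕ) / Real.sqrt d)) ^ d) ^ (p - 1)) * momentConst D (2 * (k + 1)) (max (max 1 (1 / (γA - Jc))) ((1 + V * M / (γA - Jc)) * (γ * (γ ^ j * b)))).toNNReal) ^ (k + 1))) +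
                                2 ^ ((k + 1) * D) * 2 ^ 2 ^ ((k + 1) * D) * (max (max 1 (1 / (γA - Jc))) ((1 + V * M / (γA - Jc)) * (γ * (γ ^ j * b)))) ^ ((k + 1) * D) * Real.exp (-(δ / 2 * ((v : ℝ) + 1))) *
                                  (A * Real.exp (δ / 2 * ((D : ℝ) ^ 2 * d)) * (L : ℝ) ^ d * ∑ p ∈ Finset.Icc 1 s, ((admissible p D).card : ℝ) *
                    ((2 / (1 - Real.exp (-((κ / 2 - δ / 2 * ((D : ℝ) ^ 2 * Real.sqrt d)) / (p : ℕ) / Real.sqrt d))) *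
                      Real.exp ((κ / 2 - δ / 2 * ((D : ℝ) ^ 2 * Real.sqrt d)) / (p : ℕ) / Real.sqrt d)) ^ d) ^ (p - 1)) ^ (k + 1)) +
                              3 ^ (k + 1) * (2 ^ (k + 1) * ((∑ π ∈ setPartitions (univ : Finset (Fin (k + 1))), ((π.card - 1)! : ℝ)) *
                                  ((min 1 (2 * (L : ℝ) ^ d * Real.exp (-((γ ^ j * b) ^ 2 / 4)))) ^ ((2 * (k + 1) : ℕ) : ℝ)⁻¹ *
                                    ((1 + ((1 + V * M / (γA - Jc)) * (γ * (γ ^ j * b)))) ^ D * (A * (L : ℝ) ^ d * ∑ p ∈ Finset.Icc 1 s, ((admissible p D).card : ℝ) *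
                    ((2 / (1 - Real.exp (-(κ / 2 / (p : ℕ) / Real.sqrt d))) * Real.exp (κ / 2 / (p : ℕ) / Real.sqrt d)) ^ d) ^ (p - 1)) * momentConst D (2 * (k + 1)) (max (max 1 (1 / (γA - Jc))) ((1 + V * M / (γA - Jc)) * (γ * (γ ^ j * b)))).toNNReal) ^ (k + 1))) +
                                (A * (L : ℝ) ^ d * ∑ p ∈ Finset.Icc 1 s, ((admissible p D).card : ℝ) *
                    ((2 / (1 - Real.exp (-(κ / 2 / (p : ℕ) / Real.sqrt d))) * Real.exp (κ / 2 / (p : ℕ) / Real.sqrt d)) ^ d) ^ (p - 1)) ^ (k + 1) * (2 ^ ((k + 1) * D) * 2 ^ 2 ^ ((k + 1) * D) *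
                                  ((((k + 1) * D : ℕ) : ℝ) * (max (max 1 (1 / (γA - Jc))) ((1 + V * M / (γA - Jc)) * (γ * (γ ^ j * b)))) ^ ((k + 1) * D) * ((V₂ * M₂ / (γA - Jc) ^ 2 * Real.exp (-(θ / 2 * ((w - v : ℕ) : ℝ))) + Real.exp (-(θ * ((w - v : ℕ) : ℝ))) / (γA - Jc)) + M₂ / (γA - Jc) * (γ * (γ ^ j * b)) * (1 + Real.sqrt d * ((L : ℝ) - 1)) * V₄ * Real.exp (-(θ / 4 * ((w - v : ℕ) : ℝ)))))))) / (k + 1)!) +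
                  ∑ k ∈ Finset.range t,
                ((2 ^ (k + 1) * (2 ^ ((k + 1) * D) * 2 ^ 2 ^ ((k + 1) * D) * (max (max 1 (1 / (γA - Jc))) ((1 + V * M / (γA - Jc)) * (γ * (γ ^ j * b)))) ^ ((k + 1) * D)) *
                ((A * Real.exp (δ / 2 * ((D : ℝ) ^ 2 * d)) *
                    Real.exp (-((κ / 2 - δ / 2 * ((D : ℝ) ^ 2 * Real.sqrt d)) / 2 * w))) * nI *
                  ∑ p ∈ Finset.Icc 1 s, ((admissible p D).card : ℝ) *
                    ((2 / (1 - Real.exp (-((κ / 2 - δ / 2 * ((D : ℝ) ^ 2 * Real.sqrt d)) / 2 / (p : ℕ) / Real.sqrt d))) *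
                      Real.exp ((κ / 2 - δ / 2 * ((D : ℝ) ^ 2 * Real.sqrt d)) / 2 / (p : ℕ) / Real.sqrt d)) ^ d) ^ (p - 1)) *
                (A * Real.exp (δ / 2 * ((D : ℝ) ^ 2 * d)) *
                  ((1 : ℝ) * (2 / (1 - Real.exp (-(δ / (2 * ((k + 1 : ℕ) : ℝ)) / Real.sqrt d))) * Real.exp (δ / (2 * ((k + 1 : ℕ) : ℝ)) / Real.sqrt d)) ^ d) *
                  ∑ p ∈ Finset.Icc 1 s, ((admissible p D).card : ℝ) *
                    ((2 / (1 - Real.exp (-((κ / 2 - δ / 2 * ((D : ℝ) ^ 2 * Real.sqrt d)) / (p : ℕ) / Real.sqrt d))) *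
                      Real.exp ((κ / 2 - δ / 2 * ((D : ℝ) ^ 2 * Real.sqrt d)) / (p : ℕ) / Real.sqrt d)) ^ d) ^ (p - 1)) ^ k
                + 2 ^ (k + 1) * (2 ^ ((k + 1) * D) * 2 ^ 2 ^ ((k + 1) * D) * (max (max 1 (1 / (γA - Jc))) ((1 + V * M / (γA - Jc)) * (γ * (γ ^ j * b)))) ^ ((k + 1) * D)) *
              (nI * (A * Real.exp (δ / 2 * ((D : ℝ) ^ 2 * d)) * Real.exp (-((κ / 2 - δ / 2 * ((D : ℝ) ^ 2 * Real.sqrt d)) / 2 * v)) *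
                (L : ℝ) ^ d * ∑ p ∈ Finset.Icc 1 s, ((admissible p D).card : ℝ) *
                    ((2 / (1 - Real.exp (-((κ / 2 - δ / 2 * ((D : ℝ) ^ 2 * Real.sqrt d)) / 2 / (p : ℕ) / Real.sqrt d))) *
                      Real.exp ((κ / 2 - δ / 2 * ((D : ℝ) ^ 2 * Real.sqrt d)) / 2 / (p : ℕ) / Real.sqrt d)) ^ d) ^ (p - 1))) *
              (A * Real.exp (δ / 2 * ((D : ℝ) ^ 2 * d)) *
                (2 / (1 - Real.exp (-(δ / (2 * ((k + 1 : ℕ) : ℝ)) / Real.sqrt d))) * Real.exp (δ / (2 * ((k + 1 : ℕ) : ℝ)) / Real.sqrt d)) ^ d *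
                ∑ p ∈ Finset.Icc 1 s, ((admissible p D).card : ℝ) *
                    ((2 / (1 - Real.exp (-((κ / 2 - δ / 2 * ((D : ℝ) ^ 2 * Real.sqrt d)) / (p : ℕ) / Real.sqrt d))) *
                      Real.exp ((κ / 2 - δ / 2 * ((D : ℝ) ^ 2 * Real.sqrt d)) / (p : ℕ) / Real.sqrt d)) ^ d) ^ (p - 1)) ^ k)
                + (2 ^ (k + 1) * (2 ^ ((k + 1) * D) * 2 ^ 2 ^ ((k + 1) * D) * (max (max 1 (1 / (γA - Jc))) ((1 + V * M / (γA - Jc)) * (γ * (γ ^ j * b)))) ^ ((k + 1) * D)) *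
                (A * Real.exp (δ / 2 * ((D : ℝ) ^ 2 * d)) * Real.exp (-((κ / 2 - δ / 2 * ((D : ℝ) ^ 2 * Real.sqrt d)) / 2 * w)) *
                  (nI * (L : ℝ) ^ d) * ∑ p ∈ Finset.Icc 1 s, ((admissible p D).card : ℝ) *
                    ((2 / (1 - Real.exp (-((κ / 2 - δ / 2 * ((D : ℝ) ^ 2 * Real.sqrt d)) / 2 / (p : ℕ) / Real.sqrt d))) *
                      Real.exp ((κ / 2 - δ / 2 * ((D : ℝ) ^ 2 * Real.sqrt d)) / 2 / (p : ℕ) / Real.sqrt d)) ^ d) ^ (p - 1)) *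
                (A * Real.exp (δ / 2 * ((D : ℝ) ^ 2 * d)) *
                  (2 / (1 - Real.exp (-(δ / (2 * ((k + 1 : ℕ) : ℝ)) / Real.sqrt d))) * Real.exp (δ / (2 * ((k + 1 : ℕ) : ℝ)) / Real.sqrt d)) ^ d *
                  ∑ p ∈ Finset.Icc 1 s, ((admissible p D).card : ℝ) *
                    ((2 / (1 - Real.exp (-((κ / 2 - δ / 2 * ((D : ℝ) ^ 2 * Real.sqrt d)) / (p : ℕ) / Real.sqrt d))) *
                      Real.exp ((κ / 2 - δ / 2 * ((D : ℝ) ^ 2 * Real.sqrt d)) / (p : ℕ) / Real.sqrt d)) ^ d) ^ (p - 1)) ^ k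
                + 2 ^ (k + 1) * (2 ^ ((k + 1) * D) * 2 ^ 2 ^ ((k + 1) * D) * (max (max 1 (1 / (γA - Jc))) ((1 + V * M / (γA - Jc)) * (γ * (γ ^ j * b)))) ^ ((k + 1) * D)) *
              (nI * (A * Real.exp (δ / 2 * ((D : ℝ) ^ 2 * d)) * Real.exp (-((κ / 2 - δ / 2 * ((D : ℝ) ^ 2 * Real.sqrt d)) / 2 * v)) *
                (L : ℝ) ^ d * ∑ p ∈ Finset.Icc 1 s, ((admissible p D).card : ℝ) *
                    ((2 / (1 - Real.exp (-((κ / 2 - δ / 2 * ((D : ℝ) ^ 2 * Real.sqrt d)) / 2 / (p : ℕ) / Real.sqrt d))) *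
                      Real.exp ((κ / 2 - δ / 2 * ((D : ℝ) ^ 2 * Real.sqrt d)) / 2 / (p : ℕ) / Real.sqrt d)) ^ d) ^ (p - 1))) *
              (A * Real.exp (δ / 2 * ((D : ℝ) ^ 2 * d)) *
                (2 / (1 - Real.exp (-(δ / (2 * ((k + 1 : ℕ) : ℝ)) / Real.sqrt d))) * Real.exp (δ / (2 * ((k + 1 : ℕ) : ℝ)) / Real.sqrt d)) ^ d *
                ∑ p ∈ Finset.Icc 1 s, ((admissible p D).card : ℝ) *
                    ((2 / (1 - Real.exp (-((κ / 2 - δ / 2 * ((D : ℝ) ^ 2 * Real.sqrt d)) / (p : ℕ) / Real.sqrt d))) *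
                      Real.exp ((κ / 2 - δ / 2 * ((D : ℝ) ^ 2 * Real.sqrt d)) / (p : ℕ) / Real.sqrt d)) ^ d) ^ (p - 1)) ^ k)
                + 2 ^ ((k + 1) * D) * 2 ^ 2 ^ ((k + 1) * D) * (max (max 1 (1 / (γA - Jc))) ((1 + V * M / (γA - Jc)) * (γ * (γ ^ j * b)))) ^ ((k + 1) * D) *
              (nI * (((k + 1 : ℕ) : ℝ) * (k : ℝ) *
                ((A * Real.exp (δ / 2 * ((D : ℝ) ^ 2 * d)) * ((L : ℝ) ^ d * (2 / (1 - Real.exp (-(δ / (2 * ((k + 1 : ℕ) : ℝ)) / Real.sqrt d))) * Real.exp (δ / (2 * ((k + 1 : ℕ) : ℝ)) / Real.sqrt d)) ^ d) *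
                    ∑ p ∈ Finset.Icc 1 s, ((admissible p D).card : ℝ) *
                    ((2 / (1 - Real.exp (-((κ / 2 - δ / 2 * ((D : ℝ) ^ 2 * Real.sqrt d)) / (p : ℕ) / Real.sqrt d))) *
                      Real.exp ((κ / 2 - δ / 2 * ((D : ℝ) ^ 2 * Real.sqrt d)) / (p : ℕ) / Real.sqrt d)) ^ d) ^ (p - 1)) * ((A * Real.exp (δ / 2 * ((D : ℝ) ^ 2 * d)) * Real.exp (-(δ / (2 * ((k + 1 : ℕ) : ℝ)) / 2 * ((w : ℝ) + v + 1))) * ((L : ℝ) ^ d * (2 / (1 - Real.exp (-(δ / (2 * ((k + 1 : ℕ) : ℝ)) / 2 / Real.sqrt d))) * Real.exp (δ / (2 * ((k + 1 : ℕ) : ℝ)) / 2 / Real.sqrt d)) ^ d) *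
                    ∑ p ∈ Finset.Icc 1 s, ((admissible p D).card : ℝ) *
                    ((2 / (1 - Real.exp (-((κ / 2 - δ / 2 * ((D : ℝ) ^ 2 * Real.sqrt d)) / (p : ℕ) / Real.sqrt d))) *
                      Real.exp ((κ / 2 - δ / 2 * ((D : ℝ) ^ 2 * Real.sqrt d)) / (p : ℕ) / Real.sqrt d)) ^ d) ^ (p - 1)) *
                   (A * Real.exp (δ / 2 * ((D : ℝ) ^ 2 * d)) * ((L : ℝ) ^ d * (2 / (1 - Real.exp (-(δ / (2 * ((k + 1 : ℕ) : ℝ)) / Real.sqrt d))) * Real.exp (δ / (2 * ((k + 1 : ℕ) : ℝ)) / Real.sqrt d)) ^ d) *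
                    ∑ p ∈ Finset.Icc 1 s, ((admissible p D).card : ℝ) *
                    ((2 / (1 - Real.exp (-((κ / 2 - δ / 2 * ((D : ℝ) ^ 2 * Real.sqrt d)) / (p : ℕ) / Real.sqrt d))) *
                      Real.exp ((κ / 2 - δ / 2 * ((D : ℝ) ^ 2 * Real.sqrt d)) / (p : ℕ) / Real.sqrt d)) ^ d) ^ (p - 1)) ^ (k - 1)))))
                + nI * ((3 : ℝ) ^ (k + 1) *
              (2 ^ ((k + 1) * D) * 2 ^ 2 ^ ((k + 1) * D) * (max (max 1 (1 / (γA - Jc))) ((1 + V * M / (γA - Jc)) * (γ * (γ ^ j * b)))) ^ ((k + 1) * D) *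
                  Real.exp (-(δ / 2 * ((v : ℝ) + 1))) *
                (A * Real.exp (δ / 2 * ((D : ℝ) ^ 2 * d)) * (L : ℝ) ^ d * ∑ p ∈ Finset.Icc 1 s, ((admissible p D).card : ℝ) *
                    ((2 / (1 - Real.exp (-((κ / 2 - δ / 2 * ((D : ℝ) ^ 2 * Real.sqrt d)) / (p : ℕ) / Real.sqrt d))) *
                      Real.exp ((κ / 2 - δ / 2 * ((D : ℝ) ^ 2 * Real.sqrt d)) / (p : ℕ) / Real.sqrt d)) ^ d) ^ (p - 1)) ^ (k + 1)))) / (k + 1)!))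

            + nI * (4 * 8 ^ d * Real.exp (-((γ ^ n * b) ^ 2 / (2 * (1 / γA)))))
            ≤ nI * errTerm S ρ₁ ρ₂ ρ₃ ρ₄ A b t := by
  -- §a  order / class constants
  have hd' : (0 : ℝ) < d := by exact_mod_cast hd
  have hκ0 : 0 ≤ κ := hκ.le
  have hρ₃0 : 0 ≤ ρ₃ := le_trans (by positivity) hρ₃
  have hρ31 : 0 ≤ ρ₃ + 1 := by linarith
  have hs1 : 0 ≤ s1Const D D d κ := s1Const_nonneg D D d hκ0
  have hΓ0 : (0 : ℝ) ≤ 1 := zero_le_one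
  have hρ₄1 : 1 ≤ ρ₄ := by
    have : 0 ≤ 8 * s1Const D D d κ * 1 ^ D * 2 ^ d := by positivity
    linarith
  have hρ₄0 : 0 ≤ ρ₄ := zero_le_one.trans hρ₄1
  have hρ₄v : 8 * s1Const D D d κ * 1 ^ D * 2 ^ d ≤ ρ₄ := by linarith
  have hgap : 0 < γA - Jc := by linarith
  have hsd : 0 < Real.sqrt d := Real.sqrt_pos.mpr hd'
  have hθd : 0 < θ / Real.sqrt d := div_pos hθ hsd
  have hCu0 : 0 ≤ 1 + V * M / (γA - Jc) := by
    have : 0 ≤ V * M / (γA - Jc) := div_nonneg (mul_nonneg hV hM) hgap.le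
    linarith
  -- §b  the rate `δ ≤ θ/√d` with `δD²√d < ϰ`
  obtain ⟨δ, hδ, hδle, hres⟩ : ∃ δ : ℝ, 0 < δ ∧ δ ≤ θ / Real.sqrt d ∧ 0 < κ / 2 - δ / 2 * ((D : ℝ) ^ 2 * Real.sqrt d) := by
    refine ⟨min (θ / Real.sqrt d) (κ / ((D : ℝ) ^ 2 * Real.sqrt d + 1)), lt_min hθd (by positivity), min_le_left _ _, ?_⟩
    set X : ℝ := (D : ℝ) ^ 2 * Real.sqrt d with hX
    have hX0 : 0 ≤ X := by positivity
    have h1 : min (θ / Real.sqrt d) (κ / (X + 1)) ≤ κ / (X + 1) := min_le_right _ _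
    have h2 : κ / (X + 1) * X < κ := by
      have h3 : κ / (X + 1) * X = κ * (X / (X + 1)) := by ring
      rw [h3]
      exact mul_lt_of_lt_one_right hκ ((div_lt_one (by positivity)).mpr (by linarith))
    nlinarith [mul_le_mul_of_nonneg_right h1 hX0]
  have hδ0 : 0 ≤ δ := hδ.le
  have hκ'0 : 0 ≤ κ / 2 - δ / 2 * ((D : ℝ) ^ 2 * Real.sqrt d) := hres.le
  -- §c  the corridor multiplier `M_reg`, the narrow width `v₀`, the regime threshold `b₀`
  obtain ⟨Mr, hMr0, hMκ, hMκ', hMδ, hML, hMe⟩ := exists_M_upper hρ31 hκ hres hδ (by positivity : 0 < θ / 4) t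
  have hMθ : ρ₃ + 1 ≤ θ * Mr := hML.trans (by nlinarith)
  set v₀ : ℕ := ⌈1 / (2 * θ) + Real.sqrt (Jc / γA) / θ⌉₊ + 1 with hv₀
  have hv₀1 : 1 ≤ v₀ := by rw [hv₀]; omega
  have hv₀ge : 1 / (2 * θ) + Real.sqrt (Jc / γA) / θ ≤ (v₀ : ℝ) := by
    rw [hv₀]; push_cast
    linarith [Nat.le_ceil (1 / (2 * θ) + Real.sqrt (Jc / γA) / θ)]
  have hsq0 : 0 ≤ Real.sqrt (Jc / γA) := Real.sqrt_nonneg _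
  have hW1₀ : 1 ≤ 2 * θ * (v₀ : ℝ) := by
    have h1 : 1 / (2 * θ) ≤ (v₀ : ℝ) := le_trans (by linarith [div_nonneg hsq0 hθ.le]) hv₀ge
    have h2 : 2 * θ * (1 / (2 * θ)) = 1 := by field_simp
    nlinarith [mul_le_mul_of_nonneg_left h1 (by positivity : (0 : ℝ) ≤ 2 * θ)]
  have hW2₀ : 4 * Jc / γA ≤ (2 * θ * (v₀ : ℝ)) ^ 2 := by
    have h1 : Real.sqrt (Jc / γA) / θ ≤ (v₀ : ℝ) := le_trans (by linarith [show 0 ≤ 1 / (2 * θ) by positivity]) hv₀ge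
    have h2 : 2 * Real.sqrt (Jc / γA) ≤ 2 * θ * (v₀ : ℝ) := by
      have := mul_le_mul_of_nonneg_left h1 (by positivity : (0 : ℝ) ≤ 2 * θ)
      rwa [show 2 * θ * (Real.sqrt (Jc / γA) / θ) = 2 * Real.sqrt (Jc / γA) by field_simp] at this
    have h3 : (2 * Real.sqrt (Jc / γA)) ^ 2 = 4 * Jc / γA := by
      rw [mul_pow, Real.sq_sqrt (div_nonneg hJc0 hγA0.le)]; ring
    rw [← h3]
    exact pow_le_pow_left₀ (by positivity) h2 2
  set b₀ : ℝ := (10 * ((d : ℝ) + 1) * (Mr + 1)) ^ 2 + ((v₀ : ℝ) / Mr + 1) ^ 2 with hb₀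
  have hb₀0 : 0 ≤ b₀ := by rw [hb₀]; positivity
  have hb₀fit : (10 * ((d : ℝ) + 1) * (Mr + 1)) ^ 2 ≤ b₀ := by rw [hb₀]; exact le_add_of_nonneg_right (by positivity)
  have hv₀M : (v₀ : ℝ) ≤ Mr * b₀ ^ (3 / 2 : ℝ) := by
    have h1 : ((v₀ : ℝ) / Mr + 1) ^ 2 ≤ b₀ := by rw [hb₀]; exact le_add_of_nonneg_left (by positivity)
    have h1' : 1 ≤ b₀ := le_trans (by nlinarith [show 0 ≤ (v₀ : ℝ) / Mr by positivity]) h1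
    have h2 : b₀ ≤ b₀ ^ (3 / 2 : ℝ) := by
      calc b₀ = b₀ ^ (1 : ℝ) := (Real.rpow_one _).symm
        _ ≤ b₀ ^ (3 / 2 : ℝ) := Real.rpow_le_rpow_of_exponent_le h1' (by norm_num)
    have h3 : (v₀ : ℝ) ≤ Mr * ((v₀ : ℝ) / Mr + 1) ^ 2 := by
      have h4 : Mr * ((v₀ : ℝ) / Mr + 1) ^ 2 = (v₀ : ℝ) ^ 2 / Mr + 2 * v₀ + Mr := by field_simp; ring
      rw [h4]
      nlinarith [show 0 ≤ (v₀ : ℝ) ^ 2 / Mr by positivity, show (0 : ℝ) ≤ v₀ from Nat.cast_nonneg v₀]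
    calc (v₀ : ℝ) ≤ Mr * ((v₀ : ℝ) / Mr + 1) ^ 2 := h3
      _ ≤ Mr * b₀ := mul_le_mul_of_nonneg_left h1 hMr0.le
      _ ≤ Mr * b₀ ^ (3 / 2 : ℝ) := mul_le_mul_of_nonneg_left h2 hMr0.le
  -- §d  the witnesses `S` (by unification at the very end) and `δ`
  refine ⟨?S, δ, ?hS, hδ, hδle, hres, fun b hb => ?main⟩
  case main =>
    -- thresholds from `b > b*`
    have hg : 0 < γ ^ (d + 1) := pow_pos hγ0 _
    have hg1 : γ ^ (d + 1) ≤ 1 := pow_le_one₀ hγ0.le hγ1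
    have hgd : 0 < γ ^ d := pow_pos hγ0 _
    have hT0 : 0 ≤ 6 * 2 ^ d * ((d + 1).factorial : ℝ) * (4 / (γ ^ d) ^ 2) ^ (d + 1) := by positivity
    have hT1 : 0 ≤ 10 * ((d : ℝ) + 1) * (v₀ : ℝ) := by positivity
    have hT2 : 0 ≤ 2 / (γ ^ (d + 1) * Real.sqrt γA) := by positivity
    have hT3 : 0 ≤ (γ ^ (d + 1))⁻¹ := by positivity
    have hbv₀ : ((⌈1 / (2 * θ) + Real.sqrt (Jc / γA) / θ⌉₊ + 1 : ℕ) : ℝ) = (v₀ : ℝ) := by rw [hv₀]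
    rw [hbv₀] at hbs
    have hb1 : 1 ≤ b := by linarith
    have hb0 : 0 ≤ b := by linarith
    have hbb : b ≤ b ^ 2 := by nlinarith
    have hthr : 6 * 2 ^ d * ((d + 1).factorial : ℝ) * (4 / (γ ^ d) ^ 2) ^ (d + 1) ≤ b ^ 2 := by linarith
    have h10 : 10 * ((d : ℝ) + 1) * v₀ ≤ b ^ 2 := by linarith
    have hterm0 : 2 / (γ ^ (d + 1) * Real.sqrt γA) ≤ b := by linarith
    have hgb1 : 1 ≤ γ ^ (d + 1) * b := by
      have h1 : (γ ^ (d + 1))⁻¹ ≤ b := by linarith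
      have := mul_le_mul_of_nonneg_left h1 hg.le
      rwa [mul_inv_cancel₀ hg.ne'] at this
    -- parameters
    set L : ℕ := ⌈b ^ 2⌉₊ with hLdef
    set W : ℕ := (if b₀ ≤ b then ⌈Mr * b ^ (3 / 2 : ℝ)⌉₊ else v₀) with hWdef
    have hL2b : ((L : ℕ) : ℝ) ≤ 2 * b ^ 2 := natCeil_sq_le_two_mul_sq hb1
    have hL1 : 1 ≤ ((L : ℕ) : ℝ) := one_le_natCeil_sq hb1
    have hsmall : ((L : ℝ) ^ d) * Real.exp (-((γ ^ d * b) ^ 2 / 4)) ≤ 1 / 6 :=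
      natCeil_sq_pow_mul_exp_le (d := d) (b := b) (c := γ ^ d * b) (γ' := γ ^ d) hgd hb1 le_rfl hthr
    have hW1 : 1 ≤ W := by rw [hWdef]; exact one_le_regimeV₀ hMr0 hb1 hv₀1
    have hv₀W : v₀ ≤ W := by rw [hWdef]; exact le_regimeV₀ hMr0.le hb₀0 hv₀M
    have hVreg : b₀ ≤ b → Mr * b ^ (3 / 2 : ℝ) ≤ (W : ℝ) := fun h => by rw [hWdef]; exact wide_of_regime₀ h
    have hfit : (d + 1) * (2 * (2 * (2 * W) + W)) ≤ L := by rw [hWdef, hLdef]; exact shifts_fit_regime₀ hMr0.le hb₀fit h10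
    obtain ⟨hwid1, hwid2⟩ := width_rows_of_le (Jc := Jc) (γA := γA) hθ hW1₀ hW2₀ hv₀W
    have hθw : 0 < θ * ((2 * W : ℕ) : ℝ) := lt_of_lt_of_le one_pos hwid1
    have hguard : Jc / (Real.cosh (θ * ((2 * W : ℕ) : ℝ)) - 1) < γA := guard_of_width hγA0 hθw hwid2
    have hterm : ∀ n : ℕ, n ≤ d + 1 → 4 * (1 / γA) ≤ (γ ^ n * b) ^ 2 := by
      intro n hn
      have h1 : 4 * (1 / γA) ≤ (γ ^ (d + 1) * b) ^ 2 := terminal_cutoff_of_threshold hγ0 hγA0 hterm0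
      have h2 : γ ^ (d + 1) * b ≤ γ ^ n * b := mul_le_mul_of_nonneg_right (pow_le_pow_of_le_one hγ0.le hγ1 hn) hb0
      exact h1.trans (pow_le_pow_left₀ (by positivity) h2 2)
    refine ⟨L, 2 * W, W, lt_of_succ_mul_le hd (by omega) hfit, hfit, by omega, by omega, hgb1, hsmall, hguard, hterm,
      fun s n nI A hn hnI hA => ?_⟩
    have hnI0 : 0 ≤ nI := by linarith
    have hwv : (2 * W : ℕ) = 2 * W := rfl
    have hvw : W ≤ 2 * W := by omega
    have hWreg : b₀ ≤ b → Mr * b ^ (3 / 2 : ℝ) ≤ ((2 * W : ℕ) : ℝ) := fun h => (hVreg h).trans (by push_cast; linarith)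
    have hWVreg : b₀ ≤ b → Mr * b ^ (3 / 2 : ℝ) ≤ ((2 * W - W : ℕ) : ℝ) := by
      rw [show 2 * W - W = W by omega]; exact hVreg
    have hXv : (0 : ℝ) ≤ ((2 * W - W : ℕ) : ℝ) := Nat.cast_nonneg _
    have hLd0 : (0 : ℝ) ≤ ((L : ℕ) : ℝ) ^ d := by positivity
    -- §e  cut-off facts on the lower chain (`c_j = γ^j b ∈ [γ^d b, b]`)
    have hcut := fun j (hj : j ∈ Finset.range (d + 1)) => cutoff_lower (d := d) hγ0 hγ1 hb1 hj
    have hcb1 := fun j (hj : j ∈ Finset.range (d + 1)) => ((hcut j hj).2.1.trans_eq (one_mul b))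
    -- the class letters at the cut-off `c_j`
    have hKu0 := fun j (hj : j ∈ Finset.range (d + 1)) => Ku_nonneg (V := V) (M := M) hV hM hJcγ hγ0.le (hcut j hj).1
    have hKu := fun j (hj : j ∈ Finset.range (d + 1)) => Ku_row (V := V) (M := M) hV hM hJcγ hγ1 (hcut j hj).1 (hcut j hj).2.1
    have hCKu : 0 ≤ (1 + V * M / (γA - Jc)) * 1 := by rw [mul_one]; exact hCu0
    have hK0 := fun j (hj : j ∈ Finset.range (d + 1)) => K0_row (V := V) (M := M) hV hM hJcγ hb1 hγ1 (hcut j hj).1 (hcut j hj).2.1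
    have hK00 := fun j (_ : j ∈ Finset.range (d + 1)) =>
      (le_trans zero_le_one (K0_ties ((1 + V * M / (γA - Jc)) * (γ * (γ ^ j * b))) (1 / (γA - Jc))).1)
    have hc₀ := fun j (hj : j ∈ Finset.range (d + 1)) =>
      (show (((max (max 1 (1 / (γA - Jc))) ((1 + V * M / (γA - Jc)) * (γ * (γ ^ j * b)))).toNNReal : NNReal) : ℝ) ≤
          (max 1 (1 / (γA - Jc)) + (1 + V * M / (γA - Jc)) * 1) * b by
        rw [Real.coe_toNNReal _ (hK00 j hj)]; exact hK0 j hj)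
    have hgl0 : 0 ≤ 1 + Real.sqrt d * (((L : ℕ) : ℝ) - 1) := by
      have : 0 ≤ Real.sqrt d * (((L : ℕ) : ℝ) - 1) := mul_nonneg (Real.sqrt_nonneg _) (by linarith)
      linarith
    have hε0 := fun j (hj : j ∈ Finset.range (d + 1)) =>
      (show 0 ≤ (V₂ * M₂ / (γA - Jc) ^ 2 * Real.exp (-(θ / 2 * ((2 * W - W : ℕ) : ℝ))) + Real.exp (-(θ * ((2 * W - W : ℕ) : ℝ))) / (γA - Jc)) +
          M₂ / (γA - Jc) * (γ * (γ ^ j * b)) * (1 + Real.sqrt d * (((L : ℕ) : ℝ) - 1)) * V₄ * Real.exp (-(θ / 4 * ((2 * W - W : ℕ) : ℝ))) by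
        have h1 : 0 ≤ V₂ * M₂ / (γA - Jc) ^ 2 * Real.exp (-(θ / 2 * ((2 * W - W : ℕ) : ℝ))) := by positivity
        have h2 : 0 ≤ Real.exp (-(θ * ((2 * W - W : ℕ) : ℝ))) / (γA - Jc) := div_nonneg (Real.exp_pos _).le hgap.le
        have h3 : 0 ≤ M₂ / (γA - Jc) * (γ * (γ ^ j * b)) * (1 + Real.sqrt d * (((L : ℕ) : ℝ) - 1)) * V₄ *
            Real.exp (-(θ / 4 * ((2 * W - W : ℕ) : ℝ))) :=
          mul_nonneg (mul_nonneg (mul_nonneg (mul_nonneg (div_nonneg hM₂ hgap.le) (hcut j hj).2.2.2.1) hgl0) hV₄)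
            (Real.exp_pos _).le
        exact add_nonneg (add_nonneg h1 h2) h3)
    have hε := fun j (hj : j ∈ Finset.range (d + 1)) =>
      eps31_row (d := d) (Γ := 1) hV₂ hM₂ hV₄ hJcγ hθ.le hb1 hγ0.le hγ1 (hcut j hj).1 (hcut j hj).2.1 hL1 hL2b (2 * W - W)
    have hCε : 0 ≤ V₂ * M₂ / (γA - Jc) ^ 2 + 1 / (γA - Jc) + M₂ / (γA - Jc) * 1 * (1 + 2 * Real.sqrt d) * V₄ := by positivity
    -- §f  STRUCTURAL atoms (print's, by name)
    have T1 := fun j (hj : j ∈ Finset.range (d + 1)) =>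
      struct₁_le (s := s) (D := D) (d := d) (t := t) (ρ₁ := ρ₁) (ρ₂ := ρ₂) (hκ := hκ0) (hA := hA) (hb := hb1) (hΓ := hΓ0) (hc := (hcut j hj).1)
        (hcb := (hcut j hj).2.1) (hb₀ := hb₀0) (hρ₃ := hρ₃0) (hρ₄ := hρ₄1) (hN0 := hnI0) (hNle := le_refl nI) (hreg := hWreg) (hM := hMκ)
    have T2 := fun j (hj : j ∈ Finset.range (d + 1)) =>
      struct₂_le (s := s) (D := D) (d := d) (t := t) (ρ₁ := ρ₁) (ρ₂ := ρ₂) (hκ := hκ0) (hA := hA) (hb := hb1) (hΓ := hΓ0) (hc := (hcut j hj).1)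
        (hcb := (hcut j hj).2.1) (hL := hL2b) (hvw := hvw) (hb₀ := hb₀0) (hρ₃ := hρ₃0) (hρ₄ := hρ₄1) (hnI := hnI0)
        (hN0 := mul_nonneg hnI0 hLd0) (hNle := le_refl (nI * ((L : ℕ) : ℝ) ^ d)) (hN'0 := hnI0) (hN'le := le_refl nI) (hreg := hVreg) (hM := hMκ)
    -- §g  the PRICE (class, nI-form)
    have P := fun j (hj : j ∈ Finset.range (d + 1)) =>
      closed_price_le_errTerm (d := d) (ρ₁ := ρ₁) (ρ₂ := ρ₂) (t := t) (Cu := (1 + V * M / (γA - Jc) * γ) ^ 2) hθ hJc0 hγA0 (sq_nonneg _) hb1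
        (hcut j hj).1 (hcb1 j hj) hL2b hwv hnI0 (le_refl nI) hA hb₀0 hρ₃0 hρ₄1 hVreg hMθ
    -- §h  PER-BOX atoms (print's (g), (i1) by name; class (h), (i2), (i3), (i4))
    have R := fun j (hj : j ∈ Finset.range (d + 1)) =>
      errPB_remainder_le (t := t) (s := s) (D := D) (d := d) (ρ₃ := ρ₃) (hκ := hκ0) (hA := hA) (hb := hb1) (hΓ := hΓ0) (hc := (hcut j hj).1)
        (hcb := (hcut j hj).2.1) (hL := hL2b) (hρ₁ := hρ₁) (hρ₂ := hρ₂)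
    have Vol := fun j (hj : j ∈ Finset.range (d + 1)) =>
      errPB_volume_class_le (s := s) (D := D) (d := d) (hκ := hκ0) (hA := hA) (hb := hb1) (hΓ := hΓ0) (hc := (hcut j hj).1) (hcb := (hcut j hj).2.1)
        (hL := hL2b) (hV := le_refl (((L : ℕ) : ℝ) ^ d)) (hγ' := hgd) (hγc := (hcut j hj).2.2.1) (hρ₃ := hρ₃) (hρ₄ := hρ₄v)
    have Eps := fun j (hj : j ∈ Finset.range (d + 1)) (k : ℕ) =>
      errPB_eps_le (s := s) (D := D) (d := d) (hκ := hκ0) (hA := hA) (hb := hb1) (hΓ := hΓ0) (hc := (hcut j hj).1) (hcb := (hcut j hj).2.1)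
        (hL := hL2b) (hb₀ := hb₀0) (hρ₃ := hρ₃0) (hρ₄ := hρ₄1) (hreg := hVreg) (hM := hMκ) k
    have Chi := fun j (hj : j ∈ Finset.range (d + 1)) (k : ℕ) =>
      errPB_chi_class_le (s := s) (D := D) (d := d)
        (c₀ := (max (max 1 (1 / (γA - Jc))) ((1 + V * M / (γA - Jc)) * (γ * (γ ^ j * b)))).toNNReal)
        (hκ := hκ0) (hA := hA) (hb := hb1) (hL := hL2b) (hKu0 := hKu0 j hj) (hKu := hKu j hj) (hCKu := hCKu) (hc₀ := hc₀ j hj)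
        (hV0 := hLd0) (hV := le_refl (((L : ℕ) : ℝ) ^ d)) (hγ' := hgd) (hγc := (hcut j hj).2.2.1) (hρ₃ := hρ₃0) (hρ₄ := hρ₄1) k
    have D29 := fun j (hj : j ∈ Finset.range (d + 1)) (k : ℕ) =>
      errPB_d29_class_le (s := s) (D := D) (d := d) (hA := hA) (hb := hb1) (hL := hL2b) (hK₀ := hK00 j hj) (hK₀b := hK0 j hj)
        (hδ := hδ0) (hκ' := hκ'0) (hb₀ := hb₀0) (hρ₃ := hρ₃0) (hρ₄ := hρ₄1) (hreg := hVreg) (hM := hMδ) k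
    have D31 := fun j (hj : j ∈ Finset.range (d + 1)) (k : ℕ) =>
      errPB_d31_class_le (s := s) (D := D) (d := d) (qε := 3) (hκ := hκ0) (hA := hA) (hb := hb1) (hL := hL2b) (hK₀ := hK00 j hj) (hK₀b := hK0 j hj)
        (hε0 := hε0 j hj) (hCε := hCε) (hθ₁ := (by positivity : (0 : ℝ) ≤ θ / 4)) (hX := hXv) (hε := hε j hj)
        (hb₀ := hb₀0) (hρ₃ := hρ₃0) (hρ₄ := hρ₄1) (hreg := hWVreg) (hM := hML) k
    have KS := fun j (hj : j ∈ Finset.range (d + 1)) =>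
      (Finset.sum_le_sum fun k (_ : k ∈ Finset.range t) =>
        (div_le_div_of_nonneg_right
          (add_le_add (add_le_add (Eps j hj k)
            (mul_le_mul_of_nonneg_left (add_le_add (Chi j hj k) (D29 j hj k)) (pow_nonneg (by norm_num : (0 : ℝ) ≤ 3) (k + 1))))
            (mul_le_mul_of_nonneg_left (add_le_add (Chi j hj k) (D31 j hj k)) (pow_nonneg (by norm_num : (0 : ℝ) ≤ 3) (k + 1))))
          (Nat.cast_nonneg (k + 1)!)).trans_eq (three_div_eq _ _ _ _ _ _ _ _ _)).trans_eq (Finset.sum_mul _ _ _).symm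
    have T3 := fun j (hj : j ∈ Finset.range (d + 1)) =>
      mul_le_mul_of_nonneg_left ((add_le_add (add_le_add (R j hj) (Vol j hj)) (KS j hj)).trans_eq (err_shape_eq _ _ _ _ _)) hnI0
    -- §i  CUMULANT-SIDE atoms (class, `K₀ ≤ C_K0·b` row): (a) (b) (c) (d)=(b) (e) (f)
    have Ca := fun j (hj : j ∈ Finset.range (d + 1)) (k : ℕ) =>
      cum_a_class_le (s := s) (D := D) (d := d) (t := t) (ρ₁ := ρ₁) (ρ₂ := ρ₂) (hA := hA) (hb := hb1) (hL := hL2b) (hδ := hδ0) (hκ' := hκ'0)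
        (hb₀ := hb₀0) (hρ₃ := hρ₃0) (hρ₄ := hρ₄1) (hK₀ := hK00 j hj) (hK₀b := hK0 j hj) (hN0 := hnI0) (hNle := le_refl nI) (hreg := hWreg) (hM := hMκ') k
    have Cb := fun j (hj : j ∈ Finset.range (d + 1)) (k : ℕ) =>
      cum_b_class_le (s := s) (D := D) (d := d) (t := t) (ρ₁ := ρ₁) (ρ₂ := ρ₂) (hA := hA) (hb := hb1) (hL := hL2b) (hδ := hδ0) (hκ' := hκ'0)
        (hb₀ := hb₀0) (hρ₃ := hρ₃0) (hρ₄ := hρ₄1) (hK₀ := hK00 j hj) (hK₀b := hK0 j hj) (hN0 := hnI0) (hNle := le_refl nI) (hreg := hVreg) (hM := hMκ') k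
    have Cc := fun j (hj : j ∈ Finset.range (d + 1)) (k : ℕ) =>
      cum_c_class_le (s := s) (D := D) (d := d) (t := t) (ρ₁ := ρ₁) (ρ₂ := ρ₂) (hA := hA) (hb := hb1) (hL := hL2b) (hδ := hδ0) (hκ' := hκ'0)
        (hb₀ := hb₀0) (hρ₃ := hρ₃0) (hρ₄ := hρ₄1) (hK₀ := hK00 j hj) (hK₀b := hK0 j hj) (hnI := hnI0) (hN0 := mul_nonneg hnI0 hLd0)
        (hNle := le_refl (nI * ((L : ℕ) : ℝ) ^ d)) (hreg := hWreg) (hM := hMκ') k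
    have Ce := fun j (hj : j ∈ Finset.range (d + 1)) (k : ℕ) (hk : k ∈ Finset.range t) =>
      cum_e_class_le (s := s) (D := D) (d := d) (t := t) (ρ₁ := ρ₁) (ρ₂ := ρ₂) (w := 2 * W) (hA := hA) (hb := hb1) (hL := hL2b) (hδ := hδ0) (hκ' := hκ'0)
        (hb₀ := hb₀0) (hρ₃ := hρ₃0) (hρ₄ := hρ₄1) (hK₀ := hK00 j hj) (hK₀b := hK0 j hj) (hN0 := hnI0) (hNle := le_refl nI) (hreg := hVreg)
        (hM := hMe k (Finset.mem_range.mp hk))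
    have Cf := fun j (hj : j ∈ Finset.range (d + 1)) (k : ℕ) =>
      cum_f_class_le (s := s) (D := D) (d := d) (t := t) (ρ₁ := ρ₁) (ρ₂ := ρ₂) (hA := hA) (hb := hb1) (hL := hL2b) (hδ := hδ0) (hκ' := hκ'0)
        (hb₀ := hb₀0) (hρ₃ := hρ₃0) (hρ₄ := hρ₄1) (hK₀ := hK00 j hj) (hK₀b := hK0 j hj) (hN0 := hnI0) (hNle := le_refl nI) (hreg := hVreg) (hM := hMδ) k
    have T4 := fun j (hj : j ∈ Finset.range (d + 1)) =>
      (Finset.sum_le_sum fun k (hk : k ∈ Finset.range t) =>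
        (div_le_div_of_nonneg_right
          (add_le_add (add_le_add (add_le_add (add_le_add (Ca j hj k) (reassoc_b (Cb j hj k))) (add_le_add (Cc j hj k) (reassoc_b (Cb j hj k)))) (Ce j hj k hk))
            (Cf j hj k))
          (Nat.cast_nonneg (k + 1)!)).trans_eq (six_errTerm_div_eq _ _ _ _ _ _ _ _ _ _ _ _ _ _ _)).trans_eq
        (sum_mul_errTerm_eq _ _ _ _ _ _ _ _ _ _)
    -- §j  per step, the `n ≤ d + 1` steps, the class Appendix-A atom, the fold
    have hF := fun j (hj : j ∈ Finset.range (d + 1)) =>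
      add_le_add (add_le_add (add_le_add (T1 j hj) (T2 j hj)) (P j hj)) (add_le_add (T3 j hj) (T4 j hj))
    have hsub : ∀ j ∈ Finset.range n, j ∈ Finset.range (d + 1) := fun j hj =>
      Finset.mem_range.mpr (lt_of_lt_of_le (Finset.mem_range.mp hj) hn)
    have SUM := (Finset.sum_le_sum fun j hj => hF j (hsub j hj)).trans_eq (by rw [Finset.sum_const, Finset.card_range])
    have hγn : γ ^ (d + 1) * b ≤ γ ^ n * b := mul_le_mul_of_nonneg_right (pow_le_pow_of_le_one hγ0.le hγ1 hn) hb0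
    have TA := mul_le_mul_of_nonneg_left
      (appendixA_class_term_le_snd (d := d) (ρ₃ := ρ₃) (γ' := γ ^ (d + 1)) hg hγA0 hb0 hγn hA hρ₄0) hnI0
    have key := (add_le_add SUM TA).trans (nsmul_shape5_appA_le_errTerm (t := t) hn hnI0 hA hb0)
    exact key
  case hS => exact le_max_right _ _


/-! ## §3 (v1.1, APPEND-ONLY)  `lowerpack_class'` — the pavement side `L = ⌈b²⌉`, `w = 2v` exposed -/

set_option maxHeartbeats 1600000 in
/-- ★ **LOWERPACK FOR THE CLASS, v1.1 — THE PAVEMENT SIDE EXPOSED** (seat n08-c's word W2 for the `∃`-knit of the class Basic Lemma): the statement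
of `lowerpack_class` VERBATIM with the conjuncts `L = ⌈b²⌉₊` and `w = 2v` PREPENDED to the `∃ L w v` clause and the two width rows `1 ≤ θw`,
`4J_c/γ_A ≤ (θw)²` of the closed price (`…LedgerBridge.step_geometric_le_nI`'s `hW1`, `hW2`) inserted after the guard (the v1.0 proof has all four;
an `∃` hides its witnesses, so the exposure is a re-run of the v1.0 proof with `⟨L, 2W, W, rfl, rfl, …⟩`, not a corollary).  With `L ≤ b² + 1` the
knit's admissibility reads «the sup-`(b²+1)`-thickening of `J` lies in `Λ`», uniform in everything.
[cite: BenfattoEtAl1978, Basic Lemma (4.7) p.152; §5 p.154 «ℓ ≈ b²», «Collecting all the errors» p.159, «b*» p.159; Appendix A p.161;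
Balaban1985BackgroundPropagators, (1.16)–(1.18) p.180, Sect. E p.428 (class form; ours)] -/
theorem lowerpack_class' (hd : 0 < d) {γA Jc θ V M V₂ M₂ V₄ : ℝ} (hγA0 : 0 < γA) (hJc0 : 0 ≤ Jc) (hJcγ : Jc < γA) (hθ : 0 < θ)
    (hV : 0 ≤ V) (hM : 0 ≤ M) (hV₂ : 0 ≤ V₂) (hM₂ : 0 ≤ M₂) (hV₄ : 0 ≤ V₄)
    {γ : ℝ} (hγ0 : 0 < γ) (hγ1 : γ ≤ 1)
    (t D : ℕ) {κ : ℝ} (hκ : 0 < κ) {ρ₁ ρ₂ ρ₃ ρ₄ : ℝ}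
    (hρ₁ : (D : ℝ) + 2 * d ≤ ρ₁) (hρ₂ : 0 ≤ ρ₂) (hρ₃ : (D : ℝ) + 2 * d ≤ ρ₃)
    (hρ₄ : 8 * s1Const D D d κ * 1 ^ D * 2 ^ d + 1 ≤ ρ₄)
    {bstar : ℝ} (hbs : 6 * 2 ^ d * ((d + 1).factorial : ℝ) * (4 / (γ ^ d) ^ 2) ^ (d + 1)
      + 10 * (d + 1) * ((⌈1 / (2 * θ) + Real.sqrt (Jc / γA) / θ⌉₊ + 1 : ℕ) : ℝ) + 2 / (γ ^ (d + 1) * Real.sqrt γA) + (γ ^ (d + 1))⁻¹ + 1 ≤ bstar) :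
    ∃ S δ : ℝ, 0 ≤ S ∧ 0 < δ ∧ δ ≤ θ / Real.sqrt d ∧ 0 < κ / 2 - δ / 2 * ((D : ℝ) ^ 2 * Real.sqrt d) ∧
      ∀ b : ℝ, bstar < b → ∃ L w v : ℕ, L = ⌈b ^ 2⌉₊ ∧ w = 2 * v ∧ 2 * (2 * w + v) < L ∧ (d + 1) * (2 * (2 * w + v)) ≤ L ∧ v ≤ w ∧ 1 ≤ w ∧
        1 ≤ γ ^ (d + 1) * b ∧ ((L : ℝ) ^ d) * Real.exp (-((γ ^ d * b) ^ 2 / 4)) ≤ 1 / 6 ∧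
        Jc / (Real.cosh (θ * w) - 1) < γA ∧ 1 ≤ θ * w ∧ 4 * Jc / γA ≤ (θ * w) ^ 2 ∧ (∀ n : ℕ, n ≤ d + 1 → 4 * (1 / γA) ≤ (γ ^ n * b) ^ 2) ∧
        ∀ (s n : ℕ) (nI A : ℝ), n ≤ d + 1 → 1 ≤ nI → 0 ≤ A →
          ∑ j ∈ Finset.range n,
              ((s1Const s D d κ * A * (γ ^ j * b) ^ D * Real.exp (-(κ / 4 * w)) * nI
                + s1Const s D d κ * A * (γ ^ j * b) ^ D *
                  (Real.exp (-(κ / 4 * w)) * (nI * (L : ℝ) ^ d) +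
                    Real.exp (-(κ / 4 * v)) * (nI * (L : ℝ) ^ d))
                + (32 * (Jc / γA) * (2 / (1 - Real.exp (-(θ / 2 / Real.sqrt d))) * Real.exp (θ / 2 / Real.sqrt d)) ^ d +
                    8 * Jc * ((1 + V * M / (γA - Jc) * γ) ^ 2) * (γ ^ j * b) ^ 2 *
                      ((2 * (1 + Real.sqrt d * ((L : ℝ) - 1)) ^ 2 + 128 / θ ^ 2) *
                        (2 / (1 - Real.exp (-(θ / 4 / Real.sqrt d))) * Real.exp (θ / 4 / Real.sqrt d)) ^ d)) *
                  (nI * (L : ℝ) ^ d) * Real.exp (-(θ * w / 2)))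
                + (nI *
                    (2 * (2 ^ ((t + 1).choose 2) * (4 * (s1Const s D d κ * A * (γ ^ j * b) ^ D * (L : ℝ) ^ d)) ^ (t + 1) / (t + 1)!) +
                          Real.exp (2 * (4 * (s1Const s D d κ * A * (γ ^ j * b) ^ D * (L : ℝ) ^ d))) *
                            (3 * ((L : ℝ) ^ d * Real.exp (-((γ ^ j * b) ^ 2 / 4)))) +
                          ∑ k ∈ Finset.range t,
                            (3 ^ (k + 1) * ((∑ π ∈ setPartitions (univ : Finset (Fin (k + 1))), ((π.card - 1)! : ℝ)) *
                                (s1Const s D d κ * A * (γ ^ j * b) ^ D * Real.exp (-(κ / 4 * v)) * (L : ℝ) ^ d *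
                                  (4 * (s1Const s D d κ * A * (γ ^ j * b) ^ D * (L : ℝ) ^ d)) ^ k)) +
                              3 ^ (k + 1) * (2 ^ (k + 1) * ((∑ π ∈ setPartitions (univ : Finset (Fin (k + 1))), ((π.card - 1)! : ℝ)) *
                                  ((min 1 (2 * (L : ℝ) ^ d * Real.exp (-((γ ^ j * b) ^ 2 / 4)))) ^ ((2 * (k + 1) : ℕ) : ℝ)⁻¹ *
                                    ((1 + ((1 + V * M / (γA - Jc)) * (γ * (γ ^ j * b)))) ^ D * (A * (L : ℝ) ^ d * ∑ p ∈ Finset.Icc 1 s, ((admissible p D).card : ℝ) *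
                    ((2 / (1 - Real.exp (-(κ / 2 / (p : ℕ) / Real.sqrt d))) * Real.exp (κ / 2 / (p : ℕ) / Real.sqrt d)) ^ d) ^ (p - 1)) * momentConst D (2 * (k + 1)) (max (max 1 (1 / (γA - Jc))) ((1 + V * M / (γA - Jc)) * (γ * (γ ^ j * b)))).toNNReal) ^ (k + 1))) +
                                2 ^ ((k + 1) * D) * 2 ^ 2 ^ ((k + 1) * D) * (max (max 1 (1 / (γA - Jc))) ((1 + V * M / (γA - Jc)) * (γ * (γ ^ j * b)))) ^ ((k + 1) * D) * Real.exp (-(δ / 2 * ((v : ℝ) + 1))) *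
                                  (A * Real.exp (δ / 2 * ((D : ℝ) ^ 2 * d)) * (L : ℝ) ^ d * ∑ p ∈ Finset.Icc 1 s, ((admissible p D).card : ℝ) *
                    ((2 / (1 - Real.exp (-((κ / 2 - δ / 2 * ((D : ℝ) ^ 2 * Real.sqrt d)) / (p : ℕ) / Real.sqrt d))) *
                      Real.exp ((κ / 2 - δ / 2 * ((D : ℝ) ^ 2 * Real.sqrt d)) / (p : ℕ) / Real.sqrt d)) ^ d) ^ (p - 1)) ^ (k + 1)) +
                              3 ^ (k + 1) * (2 ^ (k + 1) * ((∑ π ∈ setPartitions (univ : Finset (Fin (k + 1))), ((π.card - 1)! : ℝ)) *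
                                  ((min 1 (2 * (L : ℝ) ^ d * Real.exp (-((γ ^ j * b) ^ 2 / 4)))) ^ ((2 * (k + 1) : ℕ) : ℝ)⁻¹ *
                                    ((1 + ((1 + V * M / (γA - Jc)) * (γ * (γ ^ j * b)))) ^ D * (A * (L : ℝ) ^ d * ∑ p ∈ Finset.Icc 1 s, ((admissible p D).card : ℝ) *
                    ((2 / (1 - Real.exp (-(κ / 2 / (p : ℕ) / Real.sqrt d))) * Real.exp (κ / 2 / (p : ℕ) / Real.sqrt d)) ^ d) ^ (p - 1)) * momentConst D (2 * (k + 1)) (max (max 1 (1 / (γA - Jc))) ((1 + V * M / (γA - Jc)) * (γ * (γ ^ j * b)))).toNNReal) ^ (k + 1))) +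
                                (A * (L : ℝ) ^ d * ∑ p ∈ Finset.Icc 1 s, ((admissible p D).card : ℝ) *
                    ((2 / (1 - Real.exp (-(κ / 2 / (p : ℕ) / Real.sqrt d))) * Real.exp (κ / 2 / (p : ℕ) / Real.sqrt d)) ^ d) ^ (p - 1)) ^ (k + 1) * (2 ^ ((k + 1) * D) * 2 ^ 2 ^ ((k + 1) * D) *
                                  ((((k + 1) * D : ℕ) : ℝ) * (max (max 1 (1 / (γA - Jc))) ((1 + V * M / (γA - Jc)) * (γ * (γ ^ j * b)))) ^ ((k + 1) * D) * ((V₂ * M₂ / (γA - Jc) ^ 2 * Real.exp (-(θ / 2 * ((w - v : ℕ) : ℝ))) + Real.exp (-(θ * ((w - v : ℕ) : ℝ))) / (γA - Jc)) + M₂ / (γA - Jc) * (γ * (γ ^ j * b)) * (1 + Real.sqrt d * ((L : ℝ) - 1)) * V₄ * Real.exp (-(θ / 4 * ((w - v : ℕ) : ℝ)))))))) / (k + 1)!) +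
                  ∑ k ∈ Finset.range t,
                ((2 ^ (k + 1) * (2 ^ ((k + 1) * D) * 2 ^ 2 ^ ((k + 1) * D) * (max (max 1 (1 / (γA - Jc))) ((1 + V * M / (γA - Jc)) * (γ * (γ ^ j * b)))) ^ ((k + 1) * D)) *
                ((A * Real.exp (δ / 2 * ((D : ℝ) ^ 2 * d)) *
                    Real.exp (-((κ / 2 - δ / 2 * ((D : ℝ) ^ 2 * Real.sqrt d)) / 2 * w))) * nI *
                  ∑ p ∈ Finset.Icc 1 s, ((admissible p D).card : ℝ) *
                    ((2 / (1 - Real.exp (-((κ / 2 - δ / 2 * ((D : ℝ) ^ 2 * Real.sqrt d)) / 2 / (p : ℕ) / Real.sqrt d))) *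
                      Real.exp ((κ / 2 - δ / 2 * ((D : ℝ) ^ 2 * Real.sqrt d)) / 2 / (p : ℕ) / Real.sqrt d)) ^ d) ^ (p - 1)) *
                (A * Real.exp (δ / 2 * ((D : ℝ) ^ 2 * d)) *
                  ((1 : ℝ) * (2 / (1 - Real.exp (-(δ / (2 * ((k + 1 : ℕ) : ℝ)) / Real.sqrt d))) * Real.exp (δ / (2 * ((k + 1 : ℕ) : ℝ)) / Real.sqrt d)) ^ d) *
                  ∑ p ∈ Finset.Icc 1 s, ((admissible p D).card : ℝ) *
                    ((2 / (1 - Real.exp (-((κ / 2 - δ / 2 * ((D : ℝ) ^ 2 * Real.sqrt d)) / (p : ℕ) / Real.sqrt d))) *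
                      Real.exp ((κ / 2 - δ / 2 * ((D : ℝ) ^ 2 * Real.sqrt d)) / (p : ℕ) / Real.sqrt d)) ^ d) ^ (p - 1)) ^ k
                + 2 ^ (k + 1) * (2 ^ ((k + 1) * D) * 2 ^ 2 ^ ((k + 1) * D) * (max (max 1 (1 / (γA - Jc))) ((1 + V * M / (γA - Jc)) * (γ * (γ ^ j * b)))) ^ ((k + 1) * D)) *
              (nI * (A * Real.exp (δ / 2 * ((D : ℝ) ^ 2 * d)) * Real.exp (-((κ / 2 - δ / 2 * ((D : ℝ) ^ 2 * Real.sqrt d)) / 2 * v)) *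
                (L : ℝ) ^ d * ∑ p ∈ Finset.Icc 1 s, ((admissible p D).card : ℝ) *
                    ((2 / (1 - Real.exp (-((κ / 2 - δ / 2 * ((D : ℝ) ^ 2 * Real.sqrt d)) / 2 / (p : ℕ) / Real.sqrt d))) *
                      Real.exp ((κ / 2 - δ / 2 * ((D : ℝ) ^ 2 * Real.sqrt d)) / 2 / (p : ℕ) / Real.sqrt d)) ^ d) ^ (p - 1))) *
              (A * Real.exp (δ / 2 * ((D : ℝ) ^ 2 * d)) *
                (2 / (1 - Real.exp (-(δ / (2 * ((k + 1 : ℕ) : ℝ)) / Real.sqrt d))) * Real.exp (δ / (2 * ((k + 1 : ℕ) : ℝ)) / Real.sqrt d)) ^ d *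
                ∑ p ∈ Finset.Icc 1 s, ((admissible p D).card : ℝ) *
                    ((2 / (1 - Real.exp (-((κ / 2 - δ / 2 * ((D : ℝ) ^ 2 * Real.sqrt d)) / (p : ℕ) / Real.sqrt d))) *
                      Real.exp ((κ / 2 - δ / 2 * ((D : ℝ) ^ 2 * Real.sqrt d)) / (p : ℕ) / Real.sqrt d)) ^ d) ^ (p - 1)) ^ k)
                + (2 ^ (k + 1) * (2 ^ ((k + 1) * D) * 2 ^ 2 ^ ((k + 1) * D) * (max (max 1 (1 / (γA - Jc))) ((1 + V * M / (γA - Jc)) * (γ * (γ ^ j * b)))) ^ ((k + 1) * D)) *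
                (A * Real.exp (δ / 2 * ((D : ℝ) ^ 2 * d)) * Real.exp (-((κ / 2 - δ / 2 * ((D : ℝ) ^ 2 * Real.sqrt d)) / 2 * w)) *
                  (nI * (L : ℝ) ^ d) * ∑ p ∈ Finset.Icc 1 s, ((admissible p D).card : ℝ) *
                    ((2 / (1 - Real.exp (-((κ / 2 - δ / 2 * ((D : ℝ) ^ 2 * Real.sqrt d)) / 2 / (p : ℕ) / Real.sqrt d))) *
                      Real.exp ((κ / 2 - δ / 2 * ((D : ℝ) ^ 2 * Real.sqrt d)) / 2 / (p : ℕ) / Real.sqrt d)) ^ d) ^ (p - 1)) *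
                (A * Real.exp (δ / 2 * ((D : ℝ) ^ 2 * d)) *
                  (2 / (1 - Real.exp (-(δ / (2 * ((k + 1 : ℕ) : ℝ)) / Real.sqrt d))) * Real.exp (δ / (2 * ((k + 1 : ℕ) : ℝ)) / Real.sqrt d)) ^ d *
                  ∑ p ∈ Finset.Icc 1 s, ((admissible p D).card : ℝ) *
                    ((2 / (1 - Real.exp (-((κ / 2 - δ / 2 * ((D : ℝ) ^ 2 * Real.sqrt d)) / (p : ℕ) / Real.sqrt d))) *
                      Real.exp ((κ / 2 - δ / 2 * ((D : ℝ) ^ 2 * Real.sqrt d)) / (p : ℕ) / Real.sqrt d)) ^ d) ^ (p - 1)) ^ k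
                + 2 ^ (k + 1) * (2 ^ ((k + 1) * D) * 2 ^ 2 ^ ((k + 1) * D) * (max (max 1 (1 / (γA - Jc))) ((1 + V * M / (γA - Jc)) * (γ * (γ ^ j * b)))) ^ ((k + 1) * D)) *
              (nI * (A * Real.exp (δ / 2 * ((D : ℝ) ^ 2 * d)) * Real.exp (-((κ / 2 - δ / 2 * ((D : ℝ) ^ 2 * Real.sqrt d)) / 2 * v)) *
                (L : ℝ) ^ d * ∑ p ∈ Finset.Icc 1 s, ((admissible p D).card : ℝ) *
                    ((2 / (1 - Real.exp (-((κ / 2 - δ / 2 * ((D : ℝ) ^ 2 * Real.sqrt d)) / 2 / (p : ℕ) / Real.sqrt d))) *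
                      Real.exp ((κ / 2 - δ / 2 * ((D : ℝ) ^ 2 * Real.sqrt d)) / 2 / (p : ℕ) / Real.sqrt d)) ^ d) ^ (p - 1))) *
              (A * Real.exp (δ / 2 * ((D : ℝ) ^ 2 * d)) *
                (2 / (1 - Real.exp (-(δ / (2 * ((k + 1 : ℕ) : ℝ)) / Real.sqrt d))) * Real.exp (δ / (2 * ((k + 1 : ℕ) : ℝ)) / Real.sqrt d)) ^ d *
                ∑ p ∈ Finset.Icc 1 s, ((admissible p D).card : ℝ) *
                    ((2 / (1 - Real.exp (-((κ / 2 - δ / 2 * ((D : ℝ) ^ 2 * Real.sqrt d)) / (p : ℕ) / Real.sqrt d))) *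
                      Real.exp ((κ / 2 - δ / 2 * ((D : ℝ) ^ 2 * Real.sqrt d)) / (p : ℕ) / Real.sqrt d)) ^ d) ^ (p - 1)) ^ k)
                + 2 ^ ((k + 1) * D) * 2 ^ 2 ^ ((k + 1) * D) * (max (max 1 (1 / (γA - Jc))) ((1 + V * M / (γA - Jc)) * (γ * (γ ^ j * b)))) ^ ((k + 1) * D) *
              (nI * (((k + 1 : ℕ) : ℝ) * (k : ℝ) *
                ((A * Real.exp (δ / 2 * ((D : ℝ) ^ 2 * d)) * ((L : ℝ) ^ d * (2 / (1 - Real.exp (-(δ / (2 * ((k + 1 : ℕ) : ℝ)) / Real.sqrt d))) * Real.exp (δ / (2 * ((k + 1 : ℕ) : ℝ)) / Real.sqrt d)) ^ d) *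
                    ∑ p ∈ Finset.Icc 1 s, ((admissible p D).card : ℝ) *
                    ((2 / (1 - Real.exp (-((κ / 2 - δ / 2 * ((D : ℝ) ^ 2 * Real.sqrt d)) / (p : ℕ) / Real.sqrt d))) *
                      Real.exp ((κ / 2 - δ / 2 * ((D : ℝ) ^ 2 * Real.sqrt d)) / (p : ℕ) / Real.sqrt d)) ^ d) ^ (p - 1)) * ((A * Real.exp (δ / 2 * ((D : ℝ) ^ 2 * d)) * Real.exp (-(δ / (2 * ((k + 1 : ℕ) : ℝ)) / 2 * ((w : ℝ) + v + 1))) * ((L : ℝ) ^ d * (2 / (1 - Real.exp (-(δ / (2 * ((k + 1 : ℕ) : ℝ)) / 2 / Real.sqrt d))) * Real.exp (δ / (2 * ((k + 1 : ℕ) : ℝ)) / 2 / Real.sqrt d)) ^ d) *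
                    ∑ p ∈ Finset.Icc 1 s, ((admissible p D).card : ℝ) *
                    ((2 / (1 - Real.exp (-((κ / 2 - δ / 2 * ((D : ℝ) ^ 2 * Real.sqrt d)) / (p : ℕ) / Real.sqrt d))) *
                      Real.exp ((κ / 2 - δ / 2 * ((D : ℝ) ^ 2 * Real.sqrt d)) / (p : ℕ) / Real.sqrt d)) ^ d) ^ (p - 1)) *
                   (A * Real.exp (δ / 2 * ((D : ℝ) ^ 2 * d)) * ((L : ℝ) ^ d * (2 / (1 - Real.exp (-(δ / (2 * ((k + 1 : ℕ) : ℝ)) / Real.sqrt d))) * Real.exp (δ / (2 * ((k + 1 : ℕ) : ℝ)) / Real.sqrt d)) ^ d) *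
                    ∑ p ∈ Finset.Icc 1 s, ((admissible p D).card : ℝ) *
                    ((2 / (1 - Real.exp (-((κ / 2 - δ / 2 * ((D : ℝ) ^ 2 * Real.sqrt d)) / (p : ℕ) / Real.sqrt d))) *
                      Real.exp ((κ / 2 - δ / 2 * ((D : ℝ) ^ 2 * Real.sqrt d)) / (p : ℕ) / Real.sqrt d)) ^ d) ^ (p - 1)) ^ (k - 1)))))
                + nI * ((3 : ℝ) ^ (k + 1) *
              (2 ^ ((k + 1) * D) * 2 ^ 2 ^ ((k + 1) * D) * (max (max 1 (1 / (γA - Jc))) ((1 + V * M / (γA - Jc)) * (γ * (γ ^ j * b)))) ^ ((k + 1) * D) *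
                  Real.exp (-(δ / 2 * ((v : ℝ) + 1))) *
                (A * Real.exp (δ / 2 * ((D : ℝ) ^ 2 * d)) * (L : ℝ) ^ d * ∑ p ∈ Finset.Icc 1 s, ((admissible p D).card : ℝ) *
                    ((2 / (1 - Real.exp (-((κ / 2 - δ / 2 * ((D : ℝ) ^ 2 * Real.sqrt d)) / (p : ℕ) / Real.sqrt d))) *
                      Real.exp ((κ / 2 - δ / 2 * ((D : ℝ) ^ 2 * Real.sqrt d)) / (p : ℕ) / Real.sqrt d)) ^ d) ^ (p - 1)) ^ (k + 1)))) / (k + 1)!))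

            + nI * (4 * 8 ^ d * Real.exp (-((γ ^ n * b) ^ 2 / (2 * (1 / γA)))))
            ≤ nI * errTerm S ρ₁ ρ₂ ρ₃ ρ₄ A b t := by
  -- §a  order / class constants
  have hd' : (0 : ℝ) < d := by exact_mod_cast hd
  have hκ0 : 0 ≤ κ := hκ.le
  have hρ₃0 : 0 ≤ ρ₃ := le_trans (by positivity) hρ₃
  have hρ31 : 0 ≤ ρ₃ + 1 := by linarith
  have hs1 : 0 ≤ s1Const D D d κ := s1Const_nonneg D D d hκ0
  have hΓ0 : (0 : ℝ) ≤ 1 := zero_le_one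
  have hρ₄1 : 1 ≤ ρ₄ := by
    have : 0 ≤ 8 * s1Const D D d κ * 1 ^ D * 2 ^ d := by positivity
    linarith
  have hρ₄0 : 0 ≤ ρ₄ := zero_le_one.trans hρ₄1
  have hρ₄v : 8 * s1Const D D d κ * 1 ^ D * 2 ^ d ≤ ρ₄ := by linarith
  have hgap : 0 < γA - Jc := by linarith
  have hsd : 0 < Real.sqrt d := Real.sqrt_pos.mpr hd'
  have hθd : 0 < θ / Real.sqrt d := div_pos hθ hsd
  have hCu0 : 0 ≤ 1 + V * M / (γA - Jc) := by
    have : 0 ≤ V * M / (γA - Jc) := div_nonneg (mul_nonneg hV hM) hgap.le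
    linarith
  -- §b  the rate `δ ≤ θ/√d` with `δD²√d < ϰ`
  obtain ⟨δ, hδ, hδle, hres⟩ : ∃ δ : ℝ, 0 < δ ∧ δ ≤ θ / Real.sqrt d ∧ 0 < κ / 2 - δ / 2 * ((D : ℝ) ^ 2 * Real.sqrt d) := by
    refine ⟨min (θ / Real.sqrt d) (κ / ((D : ℝ) ^ 2 * Real.sqrt d + 1)), lt_min hθd (by positivity), min_le_left _ _, ?_⟩
    set X : ℝ := (D : ℝ) ^ 2 * Real.sqrt d with hX
    have hX0 : 0 ≤ X := by positivity
    have h1 : min (θ / Real.sqrt d) (κ / (X + 1)) ≤ κ / (X + 1) := min_le_right _ _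
    have h2 : κ / (X + 1) * X < κ := by
      have h3 : κ / (X + 1) * X = κ * (X / (X + 1)) := by ring
      rw [h3]
      exact mul_lt_of_lt_one_right hκ ((div_lt_one (by positivity)).mpr (by linarith))
    nlinarith [mul_le_mul_of_nonneg_right h1 hX0]
  have hδ0 : 0 ≤ δ := hδ.le
  have hκ'0 : 0 ≤ κ / 2 - δ / 2 * ((D : ℝ) ^ 2 * Real.sqrt d) := hres.le
  -- §c  the corridor multiplier `M_reg`, the narrow width `v₀`, the regime threshold `b₀`
  obtain ⟨Mr, hMr0, hMκ, hMκ', hMδ, hML, hMe⟩ := exists_M_upper hρ31 hκ hres hδ (by positivity : 0 < θ / 4) t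
  have hMθ : ρ₃ + 1 ≤ θ * Mr := hML.trans (by nlinarith)
  set v₀ : ℕ := ⌈1 / (2 * θ) + Real.sqrt (Jc / γA) / θ⌉₊ + 1 with hv₀
  have hv₀1 : 1 ≤ v₀ := by rw [hv₀]; omega
  have hv₀ge : 1 / (2 * θ) + Real.sqrt (Jc / γA) / θ ≤ (v₀ : ℝ) := by
    rw [hv₀]; push_cast
    linarith [Nat.le_ceil (1 / (2 * θ) + Real.sqrt (Jc / γA) / θ)]
  have hsq0 : 0 ≤ Real.sqrt (Jc / γA) := Real.sqrt_nonneg _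
  have hW1₀ : 1 ≤ 2 * θ * (v₀ : ℝ) := by
    have h1 : 1 / (2 * θ) ≤ (v₀ : ℝ) := le_trans (by linarith [div_nonneg hsq0 hθ.le]) hv₀ge
    have h2 : 2 * θ * (1 / (2 * θ)) = 1 := by field_simp
    nlinarith [mul_le_mul_of_nonneg_left h1 (by positivity : (0 : ℝ) ≤ 2 * θ)]
  have hW2₀ : 4 * Jc / γA ≤ (2 * θ * (v₀ : ℝ)) ^ 2 := by
    have h1 : Real.sqrt (Jc / γA) / θ ≤ (v₀ : ℝ) := le_trans (by linarith [show 0 ≤ 1 / (2 * θ) by positivity]) hv₀ge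
    have h2 : 2 * Real.sqrt (Jc / γA) ≤ 2 * θ * (v₀ : ℝ) := by
      have := mul_le_mul_of_nonneg_left h1 (by positivity : (0 : ℝ) ≤ 2 * θ)
      rwa [show 2 * θ * (Real.sqrt (Jc / γA) / θ) = 2 * Real.sqrt (Jc / γA) by field_simp] at this
    have h3 : (2 * Real.sqrt (Jc / γA)) ^ 2 = 4 * Jc / γA := by
      rw [mul_pow, Real.sq_sqrt (div_nonneg hJc0 hγA0.le)]; ring
    rw [← h3]
    exact pow_le_pow_left₀ (by positivity) h2 2
  set b₀ : ℝ := (10 * ((d : ℝ) + 1) * (Mr + 1)) ^ 2 + ((v₀ : ℝ) / Mr + 1) ^ 2 with hb₀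
  have hb₀0 : 0 ≤ b₀ := by rw [hb₀]; positivity
  have hb₀fit : (10 * ((d : ℝ) + 1) * (Mr + 1)) ^ 2 ≤ b₀ := by rw [hb₀]; exact le_add_of_nonneg_right (by positivity)
  have hv₀M : (v₀ : ℝ) ≤ Mr * b₀ ^ (3 / 2 : ℝ) := by
    have h1 : ((v₀ : ℝ) / Mr + 1) ^ 2 ≤ b₀ := by rw [hb₀]; exact le_add_of_nonneg_left (by positivity)
    have h1' : 1 ≤ b₀ := le_trans (by nlinarith [show 0 ≤ (v₀ : ℝ) / Mr by positivity]) h1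
    have h2 : b₀ ≤ b₀ ^ (3 / 2 : ℝ) := by
      calc b₀ = b₀ ^ (1 : ℝ) := (Real.rpow_one _).symm
        _ ≤ b₀ ^ (3 / 2 : ℝ) := Real.rpow_le_rpow_of_exponent_le h1' (by norm_num)
    have h3 : (v₀ : ℝ) ≤ Mr * ((v₀ : ℝ) / Mr + 1) ^ 2 := by
      have h4 : Mr * ((v₀ : ℝ) / Mr + 1) ^ 2 = (v₀ : ℝ) ^ 2 / Mr + 2 * v₀ + Mr := by field_simp; ring
      rw [h4]
      nlinarith [show 0 ≤ (v₀ : ℝ) ^ 2 / Mr by positivity, show (0 : ℝ) ≤ v₀ from Nat.cast_nonneg v₀]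
    calc (v₀ : ℝ) ≤ Mr * ((v₀ : ℝ) / Mr + 1) ^ 2 := h3
      _ ≤ Mr * b₀ := mul_le_mul_of_nonneg_left h1 hMr0.le
      _ ≤ Mr * b₀ ^ (3 / 2 : ℝ) := mul_le_mul_of_nonneg_left h2 hMr0.le
  -- §d  the witnesses `S` (by unification at the very end) and `δ`
  refine ⟨?S, δ, ?hS, hδ, hδle, hres, fun b hb => ?main⟩
  case main =>
    -- thresholds from `b > b*`
    have hg : 0 < γ ^ (d + 1) := pow_pos hγ0 _
    have hg1 : γ ^ (d + 1) ≤ 1 := pow_le_one₀ hγ0.le hγ1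
    have hgd : 0 < γ ^ d := pow_pos hγ0 _
    have hT0 : 0 ≤ 6 * 2 ^ d * ((d + 1).factorial : ℝ) * (4 / (γ ^ d) ^ 2) ^ (d + 1) := by positivity
    have hT1 : 0 ≤ 10 * ((d : ℝ) + 1) * (v₀ : ℝ) := by positivity
    have hT2 : 0 ≤ 2 / (γ ^ (d + 1) * Real.sqrt γA) := by positivity
    have hT3 : 0 ≤ (γ ^ (d + 1))⁻¹ := by positivity
    have hbv₀ : ((⌈1 / (2 * θ) + Real.sqrt (Jc / γA) / θ⌉₊ + 1 : ℕ) : ℝ) = (v₀ : ℝ) := by rw [hv₀]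
    rw [hbv₀] at hbs
    have hb1 : 1 ≤ b := by linarith
    have hb0 : 0 ≤ b := by linarith
    have hbb : b ≤ b ^ 2 := by nlinarith
    have hthr : 6 * 2 ^ d * ((d + 1).factorial : ℝ) * (4 / (γ ^ d) ^ 2) ^ (d + 1) ≤ b ^ 2 := by linarith
    have h10 : 10 * ((d : ℝ) + 1) * v₀ ≤ b ^ 2 := by linarith
    have hterm0 : 2 / (γ ^ (d + 1) * Real.sqrt γA) ≤ b := by linarith
    have hgb1 : 1 ≤ γ ^ (d + 1) * b := by
      have h1 : (γ ^ (d + 1))⁻¹ ≤ b := by linarith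
      have := mul_le_mul_of_nonneg_left h1 hg.le
      rwa [mul_inv_cancel₀ hg.ne'] at this
    -- parameters
    set L : ℕ := ⌈b ^ 2⌉₊ with hLdef
    set W : ℕ := (if b₀ ≤ b then ⌈Mr * b ^ (3 / 2 : ℝ)⌉₊ else v₀) with hWdef
    have hL2b : ((L : ℕ) : ℝ) ≤ 2 * b ^ 2 := natCeil_sq_le_two_mul_sq hb1
    have hL1 : 1 ≤ ((L : ℕ) : ℝ) := one_le_natCeil_sq hb1
    have hsmall : ((L : ℝ) ^ d) * Real.exp (-((γ ^ d * b) ^ 2 / 4)) ≤ 1 / 6 :=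
      natCeil_sq_pow_mul_exp_le (d := d) (b := b) (c := γ ^ d * b) (γ' := γ ^ d) hgd hb1 le_rfl hthr
    have hW1 : 1 ≤ W := by rw [hWdef]; exact one_le_regimeV₀ hMr0 hb1 hv₀1
    have hv₀W : v₀ ≤ W := by rw [hWdef]; exact le_regimeV₀ hMr0.le hb₀0 hv₀M
    have hVreg : b₀ ≤ b → Mr * b ^ (3 / 2 : ℝ) ≤ (W : ℝ) := fun h => by rw [hWdef]; exact wide_of_regime₀ h
    have hfit : (d + 1) * (2 * (2 * (2 * W) + W)) ≤ L := by rw [hWdef, hLdef]; exact shifts_fit_regime₀ hMr0.le hb₀fit h10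
    obtain ⟨hwid1, hwid2⟩ := width_rows_of_le (Jc := Jc) (γA := γA) hθ hW1₀ hW2₀ hv₀W
    have hθw : 0 < θ * ((2 * W : ℕ) : ℝ) := lt_of_lt_of_le one_pos hwid1
    have hguard : Jc / (Real.cosh (θ * ((2 * W : ℕ) : ℝ)) - 1) < γA := guard_of_width hγA0 hθw hwid2
    have hterm : ∀ n : ℕ, n ≤ d + 1 → 4 * (1 / γA) ≤ (γ ^ n * b) ^ 2 := by
      intro n hn
      have h1 : 4 * (1 / γA) ≤ (γ ^ (d + 1) * b) ^ 2 := terminal_cutoff_of_threshold hγ0 hγA0 hterm0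
      have h2 : γ ^ (d + 1) * b ≤ γ ^ n * b := mul_le_mul_of_nonneg_right (pow_le_pow_of_le_one hγ0.le hγ1 hn) hb0
      exact h1.trans (pow_le_pow_left₀ (by positivity) h2 2)
    refine ⟨L, 2 * W, W, rfl, rfl, lt_of_succ_mul_le hd (by omega) hfit, hfit, by omega, by omega, hgb1, hsmall, hguard, hwid1, hwid2, hterm,
      fun s n nI A hn hnI hA => ?_⟩
    have hnI0 : 0 ≤ nI := by linarith
    have hwv : (2 * W : ℕ) = 2 * W := rfl
    have hvw : W ≤ 2 * W := by omega
    have hWreg : b₀ ≤ b → Mr * b ^ (3 / 2 : ℝ) ≤ ((2 * W : ℕ) : ℝ) := fun h => (hVreg h).trans (by push_cast; linarith)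
    have hWVreg : b₀ ≤ b → Mr * b ^ (3 / 2 : ℝ) ≤ ((2 * W - W : ℕ) : ℝ) := by
      rw [show 2 * W - W = W by omega]; exact hVreg
    have hXv : (0 : ℝ) ≤ ((2 * W - W : ℕ) : ℝ) := Nat.cast_nonneg _
    have hLd0 : (0 : ℝ) ≤ ((L : ℕ) : ℝ) ^ d := by positivity
    -- §e  cut-off facts on the lower chain (`c_j = γ^j b ∈ [γ^d b, b]`)
    have hcut := fun j (hj : j ∈ Finset.range (d + 1)) => cutoff_lower (d := d) hγ0 hγ1 hb1 hj
    have hcb1 := fun j (hj : j ∈ Finset.range (d + 1)) => ((hcut j hj).2.1.trans_eq (one_mul b))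
    -- the class letters at the cut-off `c_j`
    have hKu0 := fun j (hj : j ∈ Finset.range (d + 1)) => Ku_nonneg (V := V) (M := M) hV hM hJcγ hγ0.le (hcut j hj).1
    have hKu := fun j (hj : j ∈ Finset.range (d + 1)) => Ku_row (V := V) (M := M) hV hM hJcγ hγ1 (hcut j hj).1 (hcut j hj).2.1
    have hCKu : 0 ≤ (1 + V * M / (γA - Jc)) * 1 := by rw [mul_one]; exact hCu0
    have hK0 := fun j (hj : j ∈ Finset.range (d + 1)) => K0_row (V := V) (M := M) hV hM hJcγ hb1 hγ1 (hcut j hj).1 (hcut j hj).2.1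
    have hK00 := fun j (_ : j ∈ Finset.range (d + 1)) =>
      (le_trans zero_le_one (K0_ties ((1 + V * M / (γA - Jc)) * (γ * (γ ^ j * b))) (1 / (γA - Jc))).1)
    have hc₀ := fun j (hj : j ∈ Finset.range (d + 1)) =>
      (show (((max (max 1 (1 / (γA - Jc))) ((1 + V * M / (γA - Jc)) * (γ * (γ ^ j * b)))).toNNReal : NNReal) : ℝ) ≤
          (max 1 (1 / (γA - Jc)) + (1 + V * M / (γA - Jc)) * 1) * b by
        rw [Real.coe_toNNReal _ (hK00 j hj)]; exact hK0 j hj)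
    have hgl0 : 0 ≤ 1 + Real.sqrt d * (((L : ℕ) : ℝ) - 1) := by
      have : 0 ≤ Real.sqrt d * (((L : ℕ) : ℝ) - 1) := mul_nonneg (Real.sqrt_nonneg _) (by linarith)
      linarith
    have hε0 := fun j (hj : j ∈ Finset.range (d + 1)) =>
      (show 0 ≤ (V₂ * M₂ / (γA - Jc) ^ 2 * Real.exp (-(θ / 2 * ((2 * W - W : ℕ) : ℝ))) + Real.exp (-(θ * ((2 * W - W : ℕ) : ℝ))) / (γA - Jc)) +
          M₂ / (γA - Jc) * (γ * (γ ^ j * b)) * (1 + Real.sqrt d * (((L : ℕ) : ℝ) - 1)) * V₄ * Real.exp (-(θ / 4 * ((2 * W - W : ℕ) : ℝ))) by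
        have h1 : 0 ≤ V₂ * M₂ / (γA - Jc) ^ 2 * Real.exp (-(θ / 2 * ((2 * W - W : ℕ) : ℝ))) := by positivity
        have h2 : 0 ≤ Real.exp (-(θ * ((2 * W - W : ℕ) : ℝ))) / (γA - Jc) := div_nonneg (Real.exp_pos _).le hgap.le
        have h3 : 0 ≤ M₂ / (γA - Jc) * (γ * (γ ^ j * b)) * (1 + Real.sqrt d * (((L : ℕ) : ℝ) - 1)) * V₄ *
            Real.exp (-(θ / 4 * ((2 * W - W : ℕ) : ℝ))) :=
          mul_nonneg (mul_nonneg (mul_nonneg (mul_nonneg (div_nonneg hM₂ hgap.le) (hcut j hj).2.2.2.1) hgl0) hV₄)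
            (Real.exp_pos _).le
        exact add_nonneg (add_nonneg h1 h2) h3)
    have hε := fun j (hj : j ∈ Finset.range (d + 1)) =>
      eps31_row (d := d) (Γ := 1) hV₂ hM₂ hV₄ hJcγ hθ.le hb1 hγ0.le hγ1 (hcut j hj).1 (hcut j hj).2.1 hL1 hL2b (2 * W - W)
    have hCε : 0 ≤ V₂ * M₂ / (γA - Jc) ^ 2 + 1 / (γA - Jc) + M₂ / (γA - Jc) * 1 * (1 + 2 * Real.sqrt d) * V₄ := by positivity
    -- §f  STRUCTURAL atoms (print's, by name)
    have T1 := fun j (hj : j ∈ Finset.range (d + 1)) =>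
      struct₁_le (s := s) (D := D) (d := d) (t := t) (ρ₁ := ρ₁) (ρ₂ := ρ₂) (hκ := hκ0) (hA := hA) (hb := hb1) (hΓ := hΓ0) (hc := (hcut j hj).1)
        (hcb := (hcut j hj).2.1) (hb₀ := hb₀0) (hρ₃ := hρ₃0) (hρ₄ := hρ₄1) (hN0 := hnI0) (hNle := le_refl nI) (hreg := hWreg) (hM := hMκ)
    have T2 := fun j (hj : j ∈ Finset.range (d + 1)) =>
      struct₂_le (s := s) (D := D) (d := d) (t := t) (ρ₁ := ρ₁) (ρ₂ := ρ₂) (hκ := hκ0) (hA := hA) (hb := hb1) (hΓ := hΓ0) (hc := (hcut j hj).1)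
        (hcb := (hcut j hj).2.1) (hL := hL2b) (hvw := hvw) (hb₀ := hb₀0) (hρ₃ := hρ₃0) (hρ₄ := hρ₄1) (hnI := hnI0)
        (hN0 := mul_nonneg hnI0 hLd0) (hNle := le_refl (nI * ((L : ℕ) : ℝ) ^ d)) (hN'0 := hnI0) (hN'le := le_refl nI) (hreg := hVreg) (hM := hMκ)
    -- §g  the PRICE (class, nI-form)
    have P := fun j (hj : j ∈ Finset.range (d + 1)) =>
      closed_price_le_errTerm (d := d) (ρ₁ := ρ₁) (ρ₂ := ρ₂) (t := t) (Cu := (1 + V * M / (γA - Jc) * γ) ^ 2) hθ hJc0 hγA0 (sq_nonneg _) hb1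
        (hcut j hj).1 (hcb1 j hj) hL2b hwv hnI0 (le_refl nI) hA hb₀0 hρ₃0 hρ₄1 hVreg hMθ
    -- §h  PER-BOX atoms (print's (g), (i1) by name; class (h), (i2), (i3), (i4))
    have R := fun j (hj : j ∈ Finset.range (d + 1)) =>
      errPB_remainder_le (t := t) (s := s) (D := D) (d := d) (ρ₃ := ρ₃) (hκ := hκ0) (hA := hA) (hb := hb1) (hΓ := hΓ0) (hc := (hcut j hj).1)
        (hcb := (hcut j hj).2.1) (hL := hL2b) (hρ₁ := hρ₁) (hρ₂ := hρ₂)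
    have Vol := fun j (hj : j ∈ Finset.range (d + 1)) =>
      errPB_volume_class_le (s := s) (D := D) (d := d) (hκ := hκ0) (hA := hA) (hb := hb1) (hΓ := hΓ0) (hc := (hcut j hj).1) (hcb := (hcut j hj).2.1)
        (hL := hL2b) (hV := le_refl (((L : ℕ) : ℝ) ^ d)) (hγ' := hgd) (hγc := (hcut j hj).2.2.1) (hρ₃ := hρ₃) (hρ₄ := hρ₄v)
    have Eps := fun j (hj : j ∈ Finset.range (d + 1)) (k : ℕ) =>
      errPB_eps_le (s := s) (D := D) (d := d) (hκ := hκ0) (hA := hA) (hb := hb1) (hΓ := hΓ0) (hc := (hcut j hj).1) (hcb := (hcut j hj).2.1)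
        (hL := hL2b) (hb₀ := hb₀0) (hρ₃ := hρ₃0) (hρ₄ := hρ₄1) (hreg := hVreg) (hM := hMκ) k
    have Chi := fun j (hj : j ∈ Finset.range (d + 1)) (k : ℕ) =>
      errPB_chi_class_le (s := s) (D := D) (d := d)
        (c₀ := (max (max 1 (1 / (γA - Jc))) ((1 + V * M / (γA - Jc)) * (γ * (γ ^ j * b)))).toNNReal)
        (hκ := hκ0) (hA := hA) (hb := hb1) (hL := hL2b) (hKu0 := hKu0 j hj) (hKu := hKu j hj) (hCKu := hCKu) (hc₀ := hc₀ j hj)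
        (hV0 := hLd0) (hV := le_refl (((L : ℕ) : ℝ) ^ d)) (hγ' := hgd) (hγc := (hcut j hj).2.2.1) (hρ₃ := hρ₃0) (hρ₄ := hρ₄1) k
    have D29 := fun j (hj : j ∈ Finset.range (d + 1)) (k : ℕ) =>
      errPB_d29_class_le (s := s) (D := D) (d := d) (hA := hA) (hb := hb1) (hL := hL2b) (hK₀ := hK00 j hj) (hK₀b := hK0 j hj)
        (hδ := hδ0) (hκ' := hκ'0) (hb₀ := hb₀0) (hρ₃ := hρ₃0) (hρ₄ := hρ₄1) (hreg := hVreg) (hM := hMδ) k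
    have D31 := fun j (hj : j ∈ Finset.range (d + 1)) (k : ℕ) =>
      errPB_d31_class_le (s := s) (D := D) (d := d) (qε := 3) (hκ := hκ0) (hA := hA) (hb := hb1) (hL := hL2b) (hK₀ := hK00 j hj) (hK₀b := hK0 j hj)
        (hε0 := hε0 j hj) (hCε := hCε) (hθ₁ := (by positivity : (0 : ℝ) ≤ θ / 4)) (hX := hXv) (hε := hε j hj)
        (hb₀ := hb₀0) (hρ₃ := hρ₃0) (hρ₄ := hρ₄1) (hreg := hWVreg) (hM := hML) k
    have KS := fun j (hj : j ∈ Finset.range (d + 1)) =>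
      (Finset.sum_le_sum fun k (_ : k ∈ Finset.range t) =>
        (div_le_div_of_nonneg_right
          (add_le_add (add_le_add (Eps j hj k)
            (mul_le_mul_of_nonneg_left (add_le_add (Chi j hj k) (D29 j hj k)) (pow_nonneg (by norm_num : (0 : ℝ) ≤ 3) (k + 1))))
            (mul_le_mul_of_nonneg_left (add_le_add (Chi j hj k) (D31 j hj k)) (pow_nonneg (by norm_num : (0 : ℝ) ≤ 3) (k + 1))))
          (Nat.cast_nonneg (k + 1)!)).trans_eq (three_div_eq _ _ _ _ _ _ _ _ _)).trans_eq (Finset.sum_mul _ _ _).symm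
    have T3 := fun j (hj : j ∈ Finset.range (d + 1)) =>
      mul_le_mul_of_nonneg_left ((add_le_add (add_le_add (R j hj) (Vol j hj)) (KS j hj)).trans_eq (err_shape_eq _ _ _ _ _)) hnI0
    -- §i  CUMULANT-SIDE atoms (class, `K₀ ≤ C_K0·b` row): (a) (b) (c) (d)=(b) (e) (f)
    have Ca := fun j (hj : j ∈ Finset.range (d + 1)) (k : ℕ) =>
      cum_a_class_le (s := s) (D := D) (d := d) (t := t) (ρ₁ := ρ₁) (ρ₂ := ρ₂) (hA := hA) (hb := hb1) (hL := hL2b) (hδ := hδ0) (hκ' := hκ'0)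
        (hb₀ := hb₀0) (hρ₃ := hρ₃0) (hρ₄ := hρ₄1) (hK₀ := hK00 j hj) (hK₀b := hK0 j hj) (hN0 := hnI0) (hNle := le_refl nI) (hreg := hWreg) (hM := hMκ') k
    have Cb := fun j (hj : j ∈ Finset.range (d + 1)) (k : ℕ) =>
      cum_b_class_le (s := s) (D := D) (d := d) (t := t) (ρ₁ := ρ₁) (ρ₂ := ρ₂) (hA := hA) (hb := hb1) (hL := hL2b) (hδ := hδ0) (hκ' := hκ'0)
        (hb₀ := hb₀0) (hρ₃ := hρ₃0) (hρ₄ := hρ₄1) (hK₀ := hK00 j hj) (hK₀b := hK0 j hj) (hN0 := hnI0) (hNle := le_refl nI) (hreg := hVreg) (hM := hMκ') k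
    have Cc := fun j (hj : j ∈ Finset.range (d + 1)) (k : ℕ) =>
      cum_c_class_le (s := s) (D := D) (d := d) (t := t) (ρ₁ := ρ₁) (ρ₂ := ρ₂) (hA := hA) (hb := hb1) (hL := hL2b) (hδ := hδ0) (hκ' := hκ'0)
        (hb₀ := hb₀0) (hρ₃ := hρ₃0) (hρ₄ := hρ₄1) (hK₀ := hK00 j hj) (hK₀b := hK0 j hj) (hnI := hnI0) (hN0 := mul_nonneg hnI0 hLd0)
        (hNle := le_refl (nI * ((L : ℕ) : ℝ) ^ d)) (hreg := hWreg) (hM := hMκ') k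
    have Ce := fun j (hj : j ∈ Finset.range (d + 1)) (k : ℕ) (hk : k ∈ Finset.range t) =>
      cum_e_class_le (s := s) (D := D) (d := d) (t := t) (ρ₁ := ρ₁) (ρ₂ := ρ₂) (w := 2 * W) (hA := hA) (hb := hb1) (hL := hL2b) (hδ := hδ0) (hκ' := hκ'0)
        (hb₀ := hb₀0) (hρ₃ := hρ₃0) (hρ₄ := hρ₄1) (hK₀ := hK00 j hj) (hK₀b := hK0 j hj) (hN0 := hnI0) (hNle := le_refl nI) (hreg := hVreg)
        (hM := hMe k (Finset.mem_range.mp hk))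
    have Cf := fun j (hj : j ∈ Finset.range (d + 1)) (k : ℕ) =>
      cum_f_class_le (s := s) (D := D) (d := d) (t := t) (ρ₁ := ρ₁) (ρ₂ := ρ₂) (hA := hA) (hb := hb1) (hL := hL2b) (hδ := hδ0) (hκ' := hκ'0)
        (hb₀ := hb₀0) (hρ₃ := hρ₃0) (hρ₄ := hρ₄1) (hK₀ := hK00 j hj) (hK₀b := hK0 j hj) (hN0 := hnI0) (hNle := le_refl nI) (hreg := hVreg) (hM := hMδ) k
    have T4 := fun j (hj : j ∈ Finset.range (d + 1)) =>
      (Finset.sum_le_sum fun k (hk : k ∈ Finset.range t) =>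
        (div_le_div_of_nonneg_right
          (add_le_add (add_le_add (add_le_add (add_le_add (Ca j hj k) (reassoc_b (Cb j hj k))) (add_le_add (Cc j hj k) (reassoc_b (Cb j hj k)))) (Ce j hj k hk))
            (Cf j hj k))
          (Nat.cast_nonneg (k + 1)!)).trans_eq (six_errTerm_div_eq _ _ _ _ _ _ _ _ _ _ _ _ _ _ _)).trans_eq
        (sum_mul_errTerm_eq _ _ _ _ _ _ _ _ _ _)
    -- §j  per step, the `n ≤ d + 1` steps, the class Appendix-A atom, the fold
    have hF := fun j (hj : j ∈ Finset.range (d + 1)) =>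
      add_le_add (add_le_add (add_le_add (T1 j hj) (T2 j hj)) (P j hj)) (add_le_add (T3 j hj) (T4 j hj))
    have hsub : ∀ j ∈ Finset.range n, j ∈ Finset.range (d + 1) := fun j hj =>
      Finset.mem_range.mpr (lt_of_lt_of_le (Finset.mem_range.mp hj) hn)
    have SUM := (Finset.sum_le_sum fun j hj => hF j (hsub j hj)).trans_eq (by rw [Finset.sum_const, Finset.card_range])
    have hγn : γ ^ (d + 1) * b ≤ γ ^ n * b := mul_le_mul_of_nonneg_right (pow_le_pow_of_le_one hγ0.le hγ1 hn) hb0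
    have TA := mul_le_mul_of_nonneg_left
      (appendixA_class_term_le_snd (d := d) (ρ₃ := ρ₃) (γ' := γ ^ (d + 1)) hg hγA0 hb0 hγn hA hρ₄0) hnI0
    have key := (add_le_add SUM TA).trans (nsmul_shape5_appA_le_errTerm (t := t) hn hnI0 hA hb0)
    exact key
  case hS => exact le_max_right _ _

end Lower

end Literature.MathematicalPhysics.QuantumFieldTheory.Balaban1983to89.B1Eq324BenfattoKernelSect5LedgerDischargeLower

end
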